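/-
Copyright: statement-level skeleton of a published paper (lit-balaban cell, Phase-2 proof seat p39 gen 30). No proof claims
beyond what the kernel checks below.
-/
import Literature.MathematicalPhysics.QuantumFieldTheory.Balaban1983to89.B3Eq123RenormalizationConditions
import Literature.MathematicalPhysics.QuantumFieldTheory.Balaban1983to89.B3Eq123IndexTwoOne
import Literature.MathematicalPhysics.QuantumFieldTheory.Balaban1983to89.B3Eq124IndexTwoOne

/-!
# Bałaban, *(Higgs)₂,₃ quantum fields in a finite volume. III*, CMP 88 (1983) [Balaban1983Higgs3], p. 417: THE VACUUM-ENERGY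
# COUNTERTERM (1.24) AT THE INDEX `(α,β) = (2,2)` — the `e²λ²` term of `E₁` for the action (1.20) WITH print's counterterm series
# `δm² = Σ_{2≦α+2β≦4}e^αλ^βδm²_{(α,β)}` INSERTED, read in the order of the body of record (`∂²/∂e²` at `e = 0` OF the second right
# derivative `(∂/∂λ)⁺²` at `λ = 0⁺`), DERIVED from the measure — a second-order one-sided window calculus in `λ` under `∫dA dφ` at
# every charge, quotient curves in the charge — and REDUCED by Wick's theorem at print's `δm²_{(0,1)}` to CUMULANT FORM: the third
# joint cumulant `κ₃(Y; V_:, V_:)` of the subtracted order-`e²` insertion with two Wick-ordered quartic vertices, minus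
# `δm²_{(0,2)}·Cov₀(Y,Q)`, minus the `e²λ²`-bubble (absent from print's series); the three-loop kernels are not evaluated here

statement-level skeleton of published theorems with citation tags; proofs where landed; nothing here is a claim about the
Yang–Mills mass gap.

[cite: Balaban1983Higgs3, (1.24) p.417 (PDF 7) and the first paragraph of p.418 (PDF 8); (1.19)–(1.22) p.416 (PDF 6); (1.23) and
the paragraph before it p.417; (1.6)–(1.10) p.413 (PDF 3)] [cite: GlimmJaffeQP1987, §8.3–8.5 (Gaussian integrals, integration by
parts / Wick's theorem, Feynman graphs, perturbation series), Cor. 8.3.2, (9.1.5)].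
Unit `lit-balaban-p39-g30` (Phase-2 proof seat p39, gen 30), free-target protocol G.5-34(d), ZERO head weight: OPTIONAL LOCATED
MEMBER of row **B3.Eq1.24** of `HOME/lit-balaban-r15/ROWS-B3.md` (owner r15; head `proved`, decl of record r01's
`B1Sect1Statements.ModelData.e1R` / r15's `B3Sect1TwoPoint.E1of124R`, neither restated here); TAKING `HOME/STATUS.md`
2026-08-24T15:35:49Z, owner r15 NO OBJECTION ∕ WELCOME 15:36:41Z (two header asks, served in § «WHICH TERM OF (1.24) THIS IS»).
BRICK 17 of this seat's series on (1.19)–(1.24) (BRICK 15 `B3Eq124IndexZeroThree` = `(0,3)`, BRICK 16 `B3Eq124IndexTwoOne` = `(2,1)`,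
both landed this session).  IMPORTED: BRICK 7 `B3Eq122ChargeWick` (this seat, gen 24: the joint weight `J_e(M)(A,φ) = W_A(A)·
e^{−½⟨φ,(−Δ^η_{eA}+M)φ⟩}` of (1.19)–(1.20) in the Feynman gauge on `JCfg = (A,φ)`, its charge insertions `D₁, D₂`,
`integrable_J_mul`, `integral_J_pos`, `integral_D1_J_zero`, `integral_D2_J_zero`, `ZA_pos`, `integral_prod_WA_W0`; through it BRICK 1
`B3Eq122FirstOrderWick` (`ExpGrowth`, `expGrowth_V`, `integral_sumWick4`), `B3WickVertexCalculus` (`wick4`, `integral_wick4_mul`,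
`integral_wick4_mul_of_deg2`, `expGrowth_wick4`, `hx`, `DerivAlong`), `B3BilinearWick`, `B3WTCovariance` (`G_diag`, `C0`,
`moment2_op`), `B3WT226Traces.Z_pos`); and — since v1.1, their farm oleans being built (importer probes rc 0, 2026-08-24T17:3xZ) —
BRICK 14 `B3Eq123IndexTwoOne` (its §2 quotient curves, §3 `e = 0` moments, §4/§6/§8 `neg_le_U`, `expGrowth_U`,
`U_eq_sumWick4_of_print`, `integral_wick4_bil`, `integral_W_Y`, used BY NAME) and BRICK 10 `B3Eq123RenormalizationConditions`
(`J_mass_add`, `expGrowth_massForm`), and — since v1.2 (its olean built, importer probe rc 0 2026-08-25T01:05Z) — BRICK 16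
`B3Eq124IndexTwoOne` (`neg_le_Ue`, `expGrowth_Ue`, `sum_G_diag`, BY NAME); v1.0 (written while those oleans were unbuilt, probes
rc 75 2026-08-24T15:0xZ) carried ≈ 900 lines of PRIVATE statement-identical copies of BRICK 14 §1–§4 here (the same copies as
BRICK 16 v1.0), deleted in v1.1, and three private copies of the BRICK 16 lemmas just named, deleted in v1.2.  STILL
FILE-LOCAL (private): §5, the one-sided WINDOW calculus for the exponent `λV + λ²κQ` under `∫dA dφ` at any charge — BRICK 12
`B3Eq123IndexZeroTwo` §0–§3 = BRICK 15 §1 PORTED from the free scalar weight at `e = 0` to BRICK 7's joint weight, new proofs of the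
same shape (a port, not a copy: not replaceable by an import); BRICK 16 §6's curve `c(e)` lemmas (private there too); BRICK 15's `integral_sumWick4_massForm`
(re-proved from `integral_wick4_bil`); four small real-analysis helpers, `J_pos₀` and the counterterm bubble `integral_W0_massForm`
(private in BRICK 14 too; v1.0's copy of BRICK 10's `integral_D1_J_massCurve_zero` is replaced by the import).  Nothing of record
was or is redeclared; every public declaration below is unchanged from v1.0.  ORDER OF DIFFERENTIATION: the «λ first» data of this
file equal the «e first» iterated partials `∂^β_{λ,+}[∂^α_e log Z^{ct}(·,λ)∣₀](0⁺)` for every `(α,β)` — BRICK 18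
`B3Eq123IndexTwoOneOrders` §5 `iteratedDeriv_iteratedDerivWithin_logZct_comm_poly6` (this six-letter polynomial; this seat gen 31).

PDF held: `paper:balaban1983-higgs-2-3-quantum-fields-finite-volume` (journal page = PDF page + 410); (1.24) and the prose around
it read for BRICKS 12/13/15/16 on the ×2 renders `run/shared/lean/pub/pub-balaban/b2b-balaban-ref1/pages/1983-cmp88-higgs23-III/
1983-cmp88-higgs23-III-p007-x2.png`, `…-p008-x2.png` (quotations below as verified there by ref-1 g107/g108 and ref-4 g90/g91/g95),
the paragraph before (1.23) on p. 417 re-read on the OCR layer (`~/.lit/texts/paper-balaban1983-…/p0007.txt`, 2026-08-24).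

THE PRINTED TEXT (verbatim).  P. 417: *"This equation can be solved recursively if δm² and Σ^ε are expanded into power series in
e, λ. In our case δm² will be defined by the terms of order ≦ 4. More exactly we write δm² = Σ_{2≦α+2β≦4}e^αλ^βδm²_{(α,β)} and we
insert this into Σ^ε."*; *"Now it is easy to define the vacuum energy counterterm E₁. It is defined by the following perturbation
expansion: E₁ = Σ_{1≤α+β≤n̄}(1/(α!β!))e^αλ^β(∂^{α+β}/∂e^α∂λ^β log∫dA∫dφ e^{−S^ε(A,φ)})∣_{e=λ=0} (1.24)"*; p. 418: *"with n̄ > 12.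
In S^ε, defined in (I.1.11), we of course have dropped the term E. Terms of this expansion are described by connected graphs
without external legs (vacuum graphs). To renormalize the theory it is sufficient to take the terms in the expansion (1.24)
restricted by the condition 2 ≦ α+2β ≦ 6; the other terms are convergent as ε → 0."*  ((I.1.11) = part I's (1.11) = (1.20) + E:
the mass counterterm `½δm²∣φ∣²` IS in `S^ε`; print's series `Σ_{2≦α+2β≦4}` consists of `δm²_{(2,0)}e² + δm²_{(0,1)}λ + δm²_{(4,0)}e⁴ +
δm²_{(2,1)}e²λ + δm²_{(0,2)}λ²` (the odd-`α` ones vanishing) and has NO `e²λ²` term (`α + 2β = 6`); the index `(2,2)` of `E₁` itself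
IS in p. 418's window `2 ≦ α+2β ≦ 6`.)

WHICH TERM OF (1.24) THIS IS (owner r15's asks, 2026-08-24T15:36:41Z).  The body of record of row B3.Eq1.24 is r15's
`B3Sect1TwoPoint.E1of124R` = r01's `B1Sect1Statements.ModelData.e1R` (typer g30's `B3Eq124OneSidedBridge.E1of124R_eq_pertSum362R_sub`
displays its general term): `(1/(α!β!))·e^α·λ^β·iteratedDeriv α (e′ ↦ iteratedDerivWithin β (λ′ ↦ log Z(e′,λ′)) (Set.Ici 0) 0) 0`.
This file computes EXACTLY that iterated derivative at `(α,β) = (2,2)` for the generating function `log Z^{ct}` of the action (1.20)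
with the counterterm series inserted, on BRICK 7's Feynman-gauge carrier `Z^{ct}(e,λ) = ∫dA dφ e^{−S^ε_{e, m²+δm²(e,λ)}(A,φ)}
e^{−λΣ_yη^d∣φ(y)∣⁴}` (an identification of readings with `e1R`, said here, not a theorem — as in BRICKS 13/15/16).  ANALYTICALLY:
the INNER object `iteratedDerivWithin 2 (λ′ ↦ log Z^{ct}(e′,λ′)) (Set.Ici 0) 0` is Mathlib's second derivative WITHIN the half-line
`[0,∞)` at `0` — the right-derivative at `0⁺` of the right-derivative function `λ′ ↦ (∂/∂λ′)⁺log Z^{ct}(e′,λ′)`; §5–§7 prove that for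
every charge `e′` ON THE BALL `∣δm²_{(2,0)}e′² + δm²_{(4,0)}e′⁴∣ ≤ m²/2` (where the `λ′ = 0` mass `M_{e′} = m² + δm²_{(2,0)}e′² +
δm²_{(4,0)}e′⁴` is positive) the function `λ′ ↦ log Z^{ct}(e′,λ′)` has a derivative within `[0,∞)` at every point of a window
`[0,L_{e′})` (dominated differentiation under `∫dA dφ`, two-sided inside, one-sided at `0`) and that derivative has a right-derivative
at `0`, so the inner object is a genuine second right-derivative with the value `Var_{e′}(V_{e′}) − (δm²_{(0,2)} + δm²_{(2,2)}e′²)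
⟨Q⟩_{e′}` (`iteratedDerivWithin_two_logZct`); the OUTER `iteratedDeriv 2 (…) 0` is the ordinary second derivative at `e′ = 0`, which
sees only that ball (`Filter.EventuallyEq.iteratedDeriv_eq`) and is computed from BRICK 14's quotient curves (§8).  THE COUNTERTERM
LETTERS, one by one (r15's ask (ii); `d20, d01, d21, d02, d22, d40` = `δm²_{(2,0)}, δm²_{(0,1)}, δm²_{(2,1)}, δm²_{(0,2)}, δm²_{(2,2)},
δm²_{(4,0)}`): `δm²_{(2,0)}` ENTERS, through `Y = X − δm²_{(2,0)}Q` (the `A`-averaged order-`e²` insertion minus its counterterm),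
in both surviving cumulants; `δm²_{(0,1)}` ENTERS through `U = Σ_yη^d∣φ(y)∣⁴ + ½δm²_{(0,1)}Q` and is SET to print's `−4(N+2)C^ε_0(0)`
in §10, where it Wick-orders the quartic vertex; `δm²_{(2,1)}` enters the general formula (§9) ONLY as `2δm²_{(2,1)}·Cov₀(U,Q)` and
DROPS at print's `δm²_{(0,1)}` because `Cov₀(V_:, Q) = 0` (§10 `integral_W_massForm`: the mass vertex cannot close a graph with one
Wick-ordered quartic vertex); `δm²_{(0,2)}` ENTERS, as `−δm²_{(0,2)}·Cov₀(Y,Q)` (the `λ²` bubble dressed by the order-`e²`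
insertion); `δm²_{(2,2)}` — NOT A LETTER OF PRINT'S SERIES (`α + 2β = 6 > 4`) — is carried as a free letter `d22` for bookkeeping
and enters as the bubble `−2δm²_{(2,2)}⟨Q⟩₀`; print's value is `d22 = 0` (`iteratedDeriv_two_index22_at_print_series`);
`δm²_{(4,0)}` CANNOT reach a second `e`-derivative at `0` (`δm²_{(4,0)}e⁴ = O(e⁴)`; it only fixes the mass `M_e` on the ball) and is
absent from every right-hand side.  THE SURVIVING GRAPHS at print's counterterms (combinatoric factors being *"a part of the
graphical description"*, p. 416): `κ₃(Y; V_:, V_:)` = the connected vacuum graphs with TWO Wick-ordered quartic vertices (1.6) and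
ONE insertion from `Y` — the sunset `⟨:∣φ(y)∣⁴::∣φ(y′)∣⁴:⟩` with one of its three lines carrying ② (the `A`-tadpole on the seagull
vertex), ④ (the vector exchange between two cubic vertices) or the `−δm²_{(2,0)}` vertex, and the graph in which the vector line of
④ bridges two different sunset lines — and `−δm²_{(0,2)}·Cov₀(Y,Q)` = the `δm²_{(0,2)}` bubble with the same insertions; their
propagator sums are NOT evaluated in this file (v1.0: cumulant form).

THE SETTING = BRICK 7's / BRICK 14's / BRICK 16's: the model torus `T^{(j)}_η` of `B3WT223Instance` (print's `T_ε`, `η = ε`,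
volume element `w = η^d`, `c = η⁻¹`), scalar fields `φ : T → ℝ^N` (`Cfg`), vector fields `A` (`Cfg P j P.d`, bonds `PBond`,
`toVec`), the joint weight `J C η w c M μ2 e (A,φ)` (Feynman gauge, vector mass `μ2 > 0`), the free scalar weight `W₀ = weight C η
w c m2 0` at `e = 0` (written out in the statements), `C₀ = B3WTPropagator.G w c m2` (print's `C^ε_0`; `C₀(x,x) = C0`), the vector
propagator `G w c μ2` (print's `C^ε`), `Q(φ) = Σ_xη^d∣φ(x)∣²` (`massForm`), `U = Σ_yη^d∣φ(y)∣⁴ + ½δm²_{(0,1)}Q`, `V_: = Σ_yη^d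
:∣φ(y)∣⁴:` (`wick4`), the `A`-averaged order-`e²` insertion `X` (print's ②+④ before the scalar contractions; §3 header) and `Y = X −
δm²_{(2,0)}Q` — observables as functions with defining hypotheses (`hU`, `hX`), so every statement displays its own formula.
Hypotheses throughout: `η^d > 0`, `m² > 0`, `μ2 > 0`; any level `j`, mesh, dimension `d`, `N`, any antisymmetric charge matrix `q` of
norm ≤ 1.

WHAT THIS FILE PROVES (theorems only; no definition, no named fact, no `sorry`; standard axioms).
* §1–§4: nothing file-local beyond four small real-analysis helpers and the counterterm bubble — BRICK 14's curve lemmas, quotient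
  curves, `e = 0` moments and Wick identities are IMPORTED by name since v1.1 (list above).
* §5 (private) **THE ONE-SIDED WINDOW CALCULUS UNDER `∫dA dφ` AT ANY CHARGE** for the exponent `λV + λ²κQ` (`V ≥ −K` of
  exponential-linear growth, any `κ`, mass `M > 0`): on `0 ≤ λ < L` (`L ≤ 1`, `L∣κ∣ ≤ M/4`) the moments `N_g(λ) = ∫Je^{−(λV+λ²κQ)}g`
  are integrable (`J_Me^{(M/4)Q} = J_{M/2}`) and have the derivative `−N_{(V+2λκQ)g}` within `[0,∞)` (`integrable_momentJ`,
  `hasDerivAt_momentJ`, `hasDerivWithinAt_momentJ_zero`, `hasDerivWithinAt_momentJ`, `momentJ_one_pos`, `momentJ_split`).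
* §6 a [folklore] calculus lemma (`iteratedDerivWithin 2 (log∘M) [0,∞) 0 = (M″(0⁺)M(0) − M′(0)²)/M(0)²`) and
  **`iteratedDerivWithin_two_logMomentJ`: `iteratedDerivWithin 2 (λ ↦ log∫Je^{−(λV+λ²κQ)}) (Set.Ici 0) 0 = [(∫JV² − 2κ∫JQ)∫J −
  (∫JV)²]/(∫J)²`** at every charge and mass.
* §7 `Zct_fibre` (at fixed `e` the `λ`-part of the counterterm is the exponent `λV_e + λ²κ_eQ`, `V_e = U + ½δm²_{(2,1)}e²Q`, `κ_e =
  ½(δm²_{(0,2)} + δm²_{(2,2)}e²)`); **`iteratedDerivWithin_two_logZct`** (the inner derivative at every `e` on the mass-positivity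
  ball); `iteratedDerivWithin_two_logZct_eventuallyEq` (near `0`: `q_{U²} + δm²_{(2,1)}e²q_{UQ} + ¼δm²_{(2,1)}²e⁴q_{Q²} − (δm²_{(0,2)}
  + δm²_{(2,2)}e²)q_Q − (q_U + ½δm²_{(2,1)}e²q_Q)²` with the quotient curves `q_F = N_F/Z`).
* §8 a [folklore] calculus lemma for that combination and **`iteratedDeriv_two_index22_raw`**: `= q_{U²}″(0) + 2δm²_{(2,1)}q_{UQ}(0)
  − δm²_{(0,2)}q_Q″(0) − 2δm²_{(2,2)}q_Q(0) − 2q_U(0)q_U″(0) − 2δm²_{(2,1)}q_U(0)q_Q(0)` (`q_U′(0) = 0`: one vector leg against the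
  even Gaussian).
* §9 **`iteratedDeriv_two_index22_eq_moments`** (ANY letters): `= Cov₀(Y,U²) − 2⟨U⟩₀Cov₀(Y,U) + 2δm²_{(2,1)}Cov₀(U,Q) −
  δm²_{(0,2)}Cov₀(Y,Q) − 2δm²_{(2,2)}⟨Q⟩₀` over the common denominator `(∫W₀)²` (`Z_A` cancels).
* §10 **`iteratedDeriv_two_index22_at_print_d01`: at print's `δm²_{(0,1)} = −4(N+2)C^ε_0(0)`,
  `iteratedDeriv 2 (e ↦ iteratedDerivWithin 2 (λ ↦ log∫dA dφ e^{−S^ε}) (Set.Ici 0) 0) 0 = κ₃(Y; V_:, V_:) − δm²_{(0,2)}·Cov₀(Y,Q) −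
  2δm²_{(2,2)}·N·Σ_xη^dC^ε_0(x,x)`** (`U = V_: − ∣T∣η^dN(N+2)C₀(0)²`; `Cov₀(Y,V_:) = 0`, `⟨V_:⟩₀ = 0`, `Cov₀(V_:,Q) = 0` remove the
  constant and the `δm²_{(2,1)}` term); **`iteratedDeriv_two_index22_at_print_series`** (print's series, `d22 = 0`: `= κ₃(Y; V_:, V_:) −
  δm²_{(0,2)}·Cov₀(Y,Q)`); **`E1_term_22_at_print_d01`** (with print's prefactor `1/(2!2!) = ¼` and `e²λ²`); `bubble22_eq_card_mul`.

HONEST SCOPE.  (a) CUMULANT FORM ONLY: the third joint cumulant `κ₃(Y; V_:, V_:)` and `Cov₀(Y,Q)` are left as Gaussian integrals of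
explicit polynomials (`∫W₀·Y·V_:²`, `∫W₀·V_:²`, `∫W₀·Y`, `∫W₀·YQ`, `∫W₀·Q`); their evaluation into propagator sums (the three-loop
vacuum kernels: two Wick-ordered quartic vertices with a ②-, ④- or mass-dressed line, the bridging vector line, the dressed
`δm²_{(0,2)}` bubble) is NOT in this file.  (b) The ORDER of differentiation is the body of record's (inner `λ` one-sided at `0⁺`,
outer `e` at `0`); the other order and joint smoothness (BRICK 11) are neither used nor claimed.  (c) The inner derivative is
computed on the ball `∣δm²_{(2,0)}e² + δm²_{(4,0)}e⁴∣ ≤ m²/2` only, which is all the outer derivative sees.  (d) The letters are free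
reals; print's values of `δm²_{(2,0)}, δm²_{(2,1)}, δm²_{(0,2)}` ((1.23); BRICKS 10/12/14) are not inserted, only print's
`δm²_{(0,1)}` (§10) and `δm²_{(2,2)} = 0` (print has no such letter; `…_at_print_series`).  (e) Finite torus at fixed `ε = η`: nothing
is uniform in `ε`; p. 418's *"convergent as ε → 0"* is not touched.  (f) The identification with `E₁`'s `(2,2)` term reads (1.24)'s
`log∫dA∫dφ e^{−S^ε}` as BRICK 7's Feynman-gauge `log Z^{ct}` (as in BRICKS 7/10/13/14/16), not a theorem about `e1R`.  (g) Since v1.1/v1.2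
the lemmas of BRICKS 10/14/16 are imported by name; §5 (≈ 400 lines) remains a private PORT of BRICK 12 §0–§3 / BRICK 15 §1 to the
joint weight at charge `e` (new proofs of the same shape, not importable statements); the public statements never changed under these swaps.

References: [Balaban1983Higgs3] T. Bałaban, *(Higgs)₂,₃ quantum fields in a finite volume. III. Renormalization*, CMP 88 (1983)
411–445: (1.6)–(1.10) p. 413, (1.19)–(1.22) p. 416, (1.23)–(1.24) p. 417, p. 418; [Balaban1982Higgs1] CMP 85 (1982) 603–636:
(1.7), (1.11) pp. 604–605; [GlimmJaffeQP1987] J. Glimm, A. Jaffe, *Quantum Physics*, 2nd ed., Springer 1987: §8.3 (Cor. 8.3.2),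
§8.4–8.5, (9.1.5).  Unit `lit-balaban-p39-g30`; v1.0 p382319 ✓ e54463819b9f; v1.1 (gen 31) = IMPORT SWAP (BRICK 14 / BRICK 10
by name, v1.0's §1–§4 private copies deleted; every public statement byte-identical to v1.0); v1.2 (gen 33) = IMPORT of BRICK 16
`B3Eq124IndexTwoOne` by name (the private copies of `neg_le_Ue`, `expGrowth_Ue`, `sum_G_diag` deleted) + the two header sentences
that still described §1–§4 as private copies corrected (this list's first item and HONEST SCOPE (g)); public statements byte-identical.
-/

noncomputable section

open scoped BigOperators InnerProductSpace Topology

namespace Literature.MathematicalPhysics.QuantumFieldTheory.Balaban1983to89.B3Eq124IndexTwoTwo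

open _root_.MeasureTheory _root_.Filter
open LatticeFieldCalculus B3WT223Instance B3WTPropagator B3WTCovariance B3WickVertexCalculus B3BilinearWick
  B3Eq122ChargeWick B3Eq123Counterterms B3Eq123IndexTwoOne

variable {P : Params} {j N : ℕ} (C : HiggsLattice.ChargeData N) (η w c m2 μ2 : ℝ)

/-! ## §1–§4 (v1.1) The counterterm-curve calculus, the quotient curves, the `e = 0` moments and the Wick lemmas of
BRICK 14 `B3Eq123IndexTwoOne` §1–§8 and BRICK 10 `B3Eq123RenormalizationConditions` §1–§3 are now IMPORTED BY NAME (their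
modules are built on the Lean farm since 2026-08-24T17:3xZ); v1.0 carried PRIVATE statement-identical copies of them here.  Kept
file-local: four small real-analysis helpers and the counterterm bubble `∫W₀·Σ_xη^d∣φ(x)∣²` (private in BRICK 14). -/

omit C η w c μ2 in
/-- on the ball the running mass `m² + ct(e)` stays `≥ m²/2 > 0`. [cite: Balaban1983Higgs3, (1.20) p.416] -/
private theorem mass_pos' (hm : 0 < m2) {t : ℝ} (ht : |t| ≤ m2 / 2) : 0 < m2 + t := by
  have := neg_abs_le t
  linarith

omit C η w c m2 μ2 in
/-- membership in the ball `∣e∣ < r` in metric form. [folklore] -/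
private theorem abs_lt_of_mem_ball' {r e : ℝ} (he : e ∈ Metric.ball (0 : ℝ) r) : |e| < r := by
  rwa [Metric.mem_ball, dist_zero_right, Real.norm_eq_abs] at he

omit C η w c m2 μ2 in
/-- the ball `∣e∣ < r` is a neighbourhood of each of its points. [folklore] -/
private theorem ball_mem_nhds' {r e₀ : ℝ} (he₀ : |e₀| < r) : Metric.ball (0 : ℝ) r ∈ 𝓝 e₀ :=
  Metric.isOpen_ball.mem_nhds (by rwa [Metric.mem_ball, dist_zero_right, Real.norm_eq_abs])

/-- the joint weight is positive at every mass. [cite: Balaban1983Higgs3, (1.19) p.416] -/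
private theorem J_pos₀ (M e : ℝ) (p : JCfg P j N) : 0 < J C η w c M μ2 e p := by
  unfold J
  exact mul_pos (WA_pos η w c μ2 p.1) (weight_pos _ _)

omit C η w c μ2 in
/-- a ball on which the curve is controlled: `ct` twice differentiable, `ct″` continuous at `0`, `ct(0) = 0` ⇒ on some `∣e∣ < r`:
`∣ct∣ ≤ m²/2`, `∣ct′∣ ≤ B`, `∣ct″∣ ≤ B`. [folklore] -/
private theorem exists_ball_bounds' (hm : 0 < m2) {ct ct' ct'' : ℝ → ℝ} (hd : ∀ e, HasDerivAt ct (ct' e) e)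
    (hd' : ∀ e, HasDerivAt ct' (ct'' e) e) (hc'' : ContinuousAt ct'' 0) (h0 : ct 0 = 0) :
    ∃ r B : ℝ, 0 < r ∧ (∀ e, |e| < r → |ct e| ≤ m2 / 2) ∧ (∀ e, |e| < r → |ct' e| ≤ B) ∧
      (∀ e, |e| < r → |ct'' e| ≤ B) := by
  have h1 : ∀ᶠ e in 𝓝 (0:ℝ), dist (ct e) (ct 0) < m2 / 2 :=
    Metric.tendsto_nhds.mp (hd 0).continuousAt (m2 / 2) (half_pos hm)
  have h2 : ∀ᶠ e in 𝓝 (0:ℝ), dist (ct' e) (ct' 0) < 1 := Metric.tendsto_nhds.mp (hd' 0).continuousAt 1 one_pos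
  have h3 : ∀ᶠ e in 𝓝 (0:ℝ), dist (ct'' e) (ct'' 0) < 1 := Metric.tendsto_nhds.mp hc'' 1 one_pos
  obtain ⟨r, hr, hball⟩ := Metric.eventually_nhds_iff.mp (h1.and (h2.and h3))
  have hmem : ∀ e : ℝ, |e| < r → dist e 0 < r := fun e he => by rwa [Real.dist_eq, sub_zero]
  refine ⟨r, max (|ct' 0| + 1) (|ct'' 0| + 1), hr, fun e he => ?_, fun e he => ?_, fun e he => ?_⟩
  · have h := (hball (hmem e he)).1
    rw [Real.dist_eq, h0, sub_zero] at h
    exact h.le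
  · have h := (hball (hmem e he)).2.1
    rw [Real.dist_eq] at h
    have := abs_sub_abs_le_abs_sub (ct' e) (ct' 0)
    exact le_max_of_le_left (by linarith)
  · have h := (hball (hmem e he)).2.2
    rw [Real.dist_eq] at h
    have := abs_sub_abs_le_abs_sub (ct'' e) (ct'' 0)
    exact le_max_of_le_right (by linarith)


omit μ2 in
/-- the counterterm bubble `∫W₀·Σ_xη^d∣φ(x)∣² = Z₀·N·Σ_xη^dC₀(x,x)`. [cite: Balaban1983Higgs3, (1.7) p.413] -/
private theorem integral_W0_massForm (hw : 0 < w) (hm : 0 < m2) :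
    ∫ φ : Cfg P j N, weight C η w c m2 (0 : VecField P j ℝ) φ * massForm w φ =
      (∫ φ : Cfg P j N, weight C η w c m2 (0 : VecField P j ℝ) φ) * ((N : ℝ) * ∑ x : Site P j, w * G w c m2 x x) := by
  have hq : ∀ (φ : Cfg P j N) (x : Site P j),
      ‖φ x‖ ^ 2 = ⟪φ x, (1 : EuclideanSpace ℝ (Fin N) →L[ℝ] EuclideanSpace ℝ (Fin N)) (φ x)⟫_ℝ := fun φ x => by
    rw [one_apply_eq_self, real_inner_self_eq_norm_sq]
  have hint : ∀ x : Site P j, Integrable (fun φ : Cfg P j N => weight C η w c m2 (0 : VecField P j ℝ) φ *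
      ⟪φ x, (1 : EuclideanSpace ℝ (Fin N) →L[ℝ] EuclideanSpace ℝ (Fin N)) (φ x)⟫_ℝ) := fun x =>
    ExpGrowth.integrable C η w c m2 hw hm (ExpGrowth.inner_op_apply x x _)
  have htr : trE (1 : EuclideanSpace ℝ (Fin N) →L[ℝ] EuclideanSpace ℝ (Fin N)) = N := by
    unfold trE
    simp only [one_apply_eq_self, (EuclideanSpace.basisFun (Fin N) ℝ).orthonormal.1, real_inner_self_eq_norm_sq,
      one_pow, Finset.sum_const, Finset.card_univ, Fintype.card_fin, nsmul_eq_mul, mul_one]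
  unfold massForm
  simp_rw [hq, Finset.mul_sum]
  have hre : ∀ φ : Cfg P j N, (∑ x : Site P j, weight C η w c m2 (0 : VecField P j ℝ) φ *
      (w * ⟪φ x, (1 : EuclideanSpace ℝ (Fin N) →L[ℝ] EuclideanSpace ℝ (Fin N)) (φ x)⟫_ℝ)) =
      ∑ x : Site P j, w * (weight C η w c m2 (0 : VecField P j ℝ) φ *
        ⟪φ x, (1 : EuclideanSpace ℝ (Fin N) →L[ℝ] EuclideanSpace ℝ (Fin N)) (φ x)⟫_ℝ) := fun φ =>
    Finset.sum_congr rfl fun x _ => by ring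
  simp_rw [hre]
  rw [integral_finsetSum _ fun x _ => (hint x).const_mul w]
  simp_rw [integral_const_mul, moment2_op C η w c m2 hw hm, htr]
  exact Finset.sum_congr rfl fun x _ => by ring

/-! ## §5 ONE-SIDED DIFFERENTIATION UNDER `∫dA dφ` FOR THE EXPONENT `λV + λ²κQ`, AT ANY CHARGE `e` AND MASS `M` — the
unnormalized moments `N_g(λ) = ∫dA dφ e^{−S^ε_{e,M}}e^{−(λV+λ²κQ)}g` on the window `0 ≤ λ < L` (`L ≤ 1`, `L∣κ∣ ≤ M/4`): the PORT to
BRICK 7's joint weight `J` of BRICK 12 `B3Eq123IndexZeroTwo` §0–§3 ∕ BRICK 15 `B3Eq124IndexZeroThree` §0–§1 (written there for the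
free scalar weight at `e = 0`; same proofs, the Gaussian domination `W_{m²}e^{(m²/4)Q} = W_{m²/2}` becoming `J_Me^{(M/4)Q} = J_{M/2}`):
`N_g′(λ) = −N_{(V+2λκQ)g}(λ)` within `[0,∞)` at every point of the window — one-sided at `0` because `e^{−λΣ∣φ∣⁴}` and, for
`κ < 0`, `e^{−λ²κQ}` are not integrable beyond it -/

section MomentsJ

omit C η w c m2 μ2 in
/-- `∣e^{−u} − 1∣ ≤ ∣u∣·max(1, e^{−u})` (mean value). [folklore] -/
private theorem abs_exp_neg_sub_one_le_max (u : ℝ) : |Real.exp (-u) - 1| ≤ |u| * max 1 (Real.exp (-u)) := by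
  rcases le_or_gt 0 u with hu | hu
  · have h1 : Real.exp (-u) ≤ 1 := Real.exp_le_one_iff.mpr (by linarith)
    have h2 : 1 - u ≤ Real.exp (-u) := by linarith [Real.add_one_le_exp (-u)]
    rw [abs_of_nonpos (by linarith), abs_of_nonneg hu]
    calc -(Real.exp (-u) - 1) ≤ u := by linarith
      _ = u * 1 := (mul_one u).symm
      _ ≤ u * max 1 (Real.exp (-u)) := mul_le_mul_of_nonneg_left (le_max_left _ _) hu
  · have h1 : 1 ≤ Real.exp (-u) := Real.one_le_exp (by linarith)
    have h2 : Real.exp (-u) - 1 ≤ (-u) * Real.exp (-u) := by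
      have h := Real.add_one_le_exp u
      have h3 : Real.exp (-u) * Real.exp u = 1 := by rw [← Real.exp_add]; simp
      nlinarith [Real.exp_pos (-u)]
    rw [abs_of_nonneg (by linarith), abs_of_neg hu]
    calc Real.exp (-u) - 1 ≤ (-u) * Real.exp (-u) := h2
      _ ≤ (-u) * max 1 (Real.exp (-u)) := mul_le_mul_of_nonneg_left (le_max_right _ _) (by linarith)

omit C η w c m2 μ2 in
/-- `∣g∣` is of exponential-linear growth when `g` is. [folklore] -/
private theorem expGrowth_abs {g : Cfg P j N → ℝ} (hg : ExpGrowth g) : ExpGrowth (fun φ => |g φ|) := by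
  obtain ⟨hc, K, κ, hK, hκ, hb⟩ := hg
  exact ⟨hc.abs, K, κ, hK, hκ, fun φ => by rw [abs_abs]; exact hb φ⟩

omit m2 in
/-- `J_M·e^{(M/4)Q} = J_{M/2}` (the Gaussian domination of the window). [cite: Balaban1983Higgs3, (1.20) p.416] -/
private theorem J_mul_exp_quarter_mass (M e : ℝ) (p : JCfg P j N) :
    J C η w c M μ2 e p * Real.exp (M / 4 * massForm w p.2) = J C η w c (M / 2) μ2 e p := by
  have h := B3Eq123RenormalizationConditions.J_mass_add C η w c (M / 2) μ2 (M / 2) e p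
  rw [show M / 2 + M / 2 = M by ring] at h
  rw [h, mul_assoc, ← Real.exp_add, show -(1 / 2 : ℝ) * (M / 2) * massForm w p.2 + M / 4 * massForm w p.2 = 0 by ring,
    Real.exp_zero, mul_one]

omit C η c m2 μ2 in
/-- for `V ≥ −K`, `0 ≤ λ ≤ 1`, `λ∣κ∣ ≤ M/4`: `e^{−(λV + λ²κQ)} ≤ e^{K}·e^{(M/4)Q}`. [cite: Balaban1983Higgs3, (1.20) p.416] -/
private theorem exp_neg_exponent_le (hw : 0 ≤ w) (M : ℝ) {V : Cfg P j N → ℝ} {K : ℝ} (hK : 0 ≤ K) (hVK : ∀ φ, -K ≤ V φ)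
    {κ lam : ℝ} (hlam0 : 0 ≤ lam) (hlam1 : lam ≤ 1) (hlamκ : lam * |κ| ≤ M / 4) (φ : Cfg P j N) :
    Real.exp (-(lam * V φ + lam ^ 2 * (κ * massForm w φ))) ≤ Real.exp K * Real.exp (M / 4 * massForm w φ) := by
  rw [← Real.exp_add]
  apply Real.exp_le_exp.mpr
  have hQ : 0 ≤ massForm w φ := massForm_nonneg hw φ
  have h1 : -(lam * V φ) ≤ K := by nlinarith [hVK φ]
  have h2 : -(lam ^ 2 * (κ * massForm w φ)) ≤ M / 4 * massForm w φ := by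
    have h3 : lam ^ 2 * |κ| ≤ M / 4 := by
      have h5 : lam ^ 2 * |κ| ≤ lam * |κ| := mul_le_mul_of_nonneg_right (by nlinarith) (abs_nonneg κ)
      exact h5.trans hlamκ
    have h4 : -(lam ^ 2 * (κ * massForm w φ)) ≤ lam ^ 2 * |κ| * massForm w φ := by
      have h6 : 0 ≤ (|κ| + κ) * (lam ^ 2 * massForm w φ) :=
        mul_nonneg (by linarith [neg_abs_le κ]) (mul_nonneg (sq_nonneg lam) hQ)
      nlinarith
    have h7 : lam ^ 2 * |κ| * massForm w φ ≤ M / 4 * massForm w φ := mul_le_mul_of_nonneg_right h3 hQ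
    linarith
  linarith

omit C η w c m2 μ2 in
/-- a window `0 < L ≤ 1` with `L∣κ∣ ≤ M/4` exists for every `κ` (`M > 0`). [folklore] -/
private theorem exists_window {M : ℝ} (hM : 0 < M) (κ : ℝ) : ∃ L : ℝ, 0 < L ∧ L ≤ 1 ∧ L * |κ| ≤ M / 4 := by
  refine ⟨min 1 (M / (4 * (|κ| + 1))), lt_min zero_lt_one (by positivity), min_le_left _ _, ?_⟩
  have hk : 0 ≤ |κ| := abs_nonneg κ
  have h1 : min 1 (M / (4 * (|κ| + 1))) * |κ| ≤ M / (4 * (|κ| + 1)) * |κ| :=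
    mul_le_mul_of_nonneg_right (min_le_right _ _) hk
  have h2 : M / (4 * (|κ| + 1)) * |κ| ≤ M / 4 := by
    rw [div_mul_eq_mul_div, div_le_div_iff₀ (by positivity) (by positivity)]
    nlinarith
  exact h1.trans h2

omit m2 in
/-- the joint weight is a.e.-strongly measurable (it is integrable against every observable of exponential-linear growth).
[cite: Balaban1983Higgs3, (1.19) p.416] -/
private theorem aesm_J (hw : 0 < w) {M : ℝ} (hM : 0 < M) (hμ : 0 < μ2) (e : ℝ) :
    AEStronglyMeasurable (fun p : JCfg P j N => J C η w c M μ2 e p) volume := by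
  have h := (integrable_J_mul C η w c M μ2 hw hM hμ (ExpGrowth.const (P := P) (j := j) (N := N) (1 : ℝ)) e).aestronglyMeasurable
  exact h.congr (Filter.Eventually.of_forall fun p => by simp)

omit C η c m2 μ2 in
/-- `∂_λ e^{−(λV+λ²κQ)} = −(V + 2λκQ)e^{−(λV+λ²κQ)}`. [cite: Balaban1983Higgs3, (1.20) p.416] -/
private theorem hasDerivAt_exp_exponent (V : Cfg P j N → ℝ) (κ : ℝ) (φ : Cfg P j N) (lam : ℝ) :
    HasDerivAt (fun l : ℝ => Real.exp (-(l * V φ + l ^ 2 * (κ * massForm w φ))))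
      (-(Real.exp (-(lam * V φ + lam ^ 2 * (κ * massForm w φ))) * (V φ + 2 * lam * (κ * massForm w φ)))) lam := by
  have h1 : HasDerivAt (fun l : ℝ => -(l * V φ + l ^ 2 * (κ * massForm w φ)))
      (-(V φ + 2 * lam * (κ * massForm w φ))) lam := by
    have h := (((hasDerivAt_id lam).mul_const (V φ)).add ((hasDerivAt_pow 2 lam).mul_const (κ * massForm w φ))).neg
    refine h.congr_deriv ?_
    simp only [Nat.cast_ofNat, Nat.add_one_sub_one, pow_one, one_mul]
  have h2 := h1.exp
  refine h2.congr_deriv ?_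
  ring

omit m2 in
/-- the integrand of `N_g(λ)` is dominated by `e^{K}·J_{M/2}·∣g∣` for `0 ≤ λ ≤ L`, hence integrable.
[cite: Balaban1983Higgs3, (1.19)–(1.20) p.416] [cite: GlimmJaffeQP1987, §8.4–8.5] -/
private theorem integrable_momentJ (hw : 0 < w) {M : ℝ} (hM : 0 < M) (hμ : 0 < μ2) {V g : Cfg P j N → ℝ} (hV : ExpGrowth V)
    {K : ℝ} (hK : 0 ≤ K) (hVK : ∀ φ, -K ≤ V φ) (hg : ExpGrowth g) {κ lam : ℝ} (hlam0 : 0 ≤ lam) (hlam1 : lam ≤ 1)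
    (hlamκ : lam * |κ| ≤ M / 4) (e : ℝ) :
    Integrable (fun p : JCfg P j N => J C η w c M μ2 e p *
      (Real.exp (-(lam * V p.2 + lam ^ 2 * (κ * massForm w p.2))) * g p.2)) := by
  have hQ := B3Eq123RenormalizationConditions.expGrowth_massForm (P := P) (j := j) (N := N) w
  have hmaj : Integrable (fun p : JCfg P j N => J C η w c (M / 2) μ2 e p * |g p.2|) :=
    integrable_J_mul C η w c (M / 2) μ2 hw (half_pos hM) hμ (expGrowth_abs hg) e
  refine (hmaj.const_mul (Real.exp K)).mono' ?_ ?_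
  · exact (aesm_J C η w c μ2 hw hM hμ e).mul
      (((Real.continuous_exp.comp (((continuous_const.mul (hV.1.comp continuous_snd)).add
        ((continuous_const.mul (continuous_const.mul (hQ.1.comp continuous_snd))))).neg)).mul
          (hg.1.comp continuous_snd)).aestronglyMeasurable)
  · refine Filter.Eventually.of_forall fun p => ?_
    have hexp := exp_neg_exponent_le w hw.le M hK hVK (κ := κ) hlam0 hlam1 hlamκ p.2
    have hJpos : 0 < J C η w c M μ2 e p := J_pos₀ C η w c μ2 M e p
    rw [Real.norm_eq_abs, abs_mul, abs_mul, abs_of_pos hJpos, abs_of_pos (Real.exp_pos _)]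
    calc J C η w c M μ2 e p * (Real.exp (-(lam * V p.2 + lam ^ 2 * (κ * massForm w p.2))) * |g p.2|)
        ≤ J C η w c M μ2 e p * (Real.exp K * Real.exp (M / 4 * massForm w p.2) * |g p.2|) :=
          mul_le_mul_of_nonneg_left (mul_le_mul_of_nonneg_right hexp (abs_nonneg _)) hJpos.le
      _ = Real.exp K * (J C η w c (M / 2) μ2 e p * |g p.2|) := by
          rw [← J_mul_exp_quarter_mass C η w c μ2 M e p]; ring

omit m2 in
/-- at `λ = 0` the moments are `∫dA dφ e^{−S^ε_{e,M}}g`. [cite: Balaban1983Higgs3, (1.19) p.416] -/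
private theorem momentJ_zero (M e : ℝ) (V g : Cfg P j N → ℝ) (κ : ℝ) :
    (∫ p : JCfg P j N, J C η w c M μ2 e p *
        (Real.exp (-((0 : ℝ) * V p.2 + (0 : ℝ) ^ 2 * (κ * massForm w p.2))) * g p.2)) =
      ∫ p : JCfg P j N, J C η w c M μ2 e p * g p.2 := by
  refine integral_congr_ae (Filter.Eventually.of_forall fun p => ?_)
  show J C η w c M μ2 e p * (Real.exp (-((0 : ℝ) * V p.2 + (0 : ℝ) ^ 2 * (κ * massForm w p.2))) * g p.2) =
    J C η w c M μ2 e p * g p.2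
  simp

omit m2 in
/-- DIFFERENTIATION UNDER `∫dA dφ` AT `0 < λ₀ < L` (two-sided): `λ ↦ ∫Je^{−(λV+λ²κQ)}g` has derivative
`−∫Je^{−(λ₀V+λ₀²κQ)}(V + 2λ₀κQ)g` at `λ₀`. [cite: Balaban1983Higgs3, (1.19)–(1.21) p.416] [cite: GlimmJaffeQP1987, §8.4–8.5] -/
private theorem hasDerivAt_momentJ (hw : 0 < w) {M : ℝ} (hM : 0 < M) (hμ : 0 < μ2) {V g : Cfg P j N → ℝ} (hV : ExpGrowth V)
    {K : ℝ} (hK : 0 ≤ K) (hVK : ∀ φ, -K ≤ V φ) (hg : ExpGrowth g) {κ L lam0 : ℝ} (hL1 : L ≤ 1) (hLκ : L * |κ| ≤ M / 4)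
    (hlam0 : 0 < lam0) (hlamL : lam0 < L) (e : ℝ) :
    HasDerivAt (fun lam : ℝ => ∫ p : JCfg P j N, J C η w c M μ2 e p *
        (Real.exp (-(lam * V p.2 + lam ^ 2 * (κ * massForm w p.2))) * g p.2))
      (-(∫ p : JCfg P j N, J C η w c M μ2 e p * (Real.exp (-(lam0 * V p.2 + lam0 ^ 2 * (κ * massForm w p.2)))
        * ((V p.2 + 2 * lam0 * (κ * massForm w p.2)) * g p.2)))) lam0 := by
  have hQ := B3Eq123RenormalizationConditions.expGrowth_massForm (P := P) (j := j) (N := N) w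
  have hJm := aesm_J (P := P) (j := j) (N := N) C η w c μ2 hw hM hμ e
  have hexpc : ∀ lam : ℝ, Continuous (fun p : JCfg P j N =>
      Real.exp (-(lam * V p.2 + lam ^ 2 * (κ * massForm w p.2)))) := fun lam =>
    Real.continuous_exp.comp (((continuous_const.mul (hV.1.comp continuous_snd)).add
      ((continuous_const.mul (continuous_const.mul (hQ.1.comp continuous_snd))))).neg)
  have hmeas : ∀ lam : ℝ, AEStronglyMeasurable (fun p : JCfg P j N => J C η w c M μ2 e p *
      (Real.exp (-(lam * V p.2 + lam ^ 2 * (κ * massForm w p.2))) * g p.2)) volume := fun lam =>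
    hJm.mul (((hexpc lam).mul (hg.1.comp continuous_snd)).aestronglyMeasurable)
  have hmeas' : ∀ lam : ℝ, AEStronglyMeasurable (fun p : JCfg P j N => J C η w c M μ2 e p *
      (-(Real.exp (-(lam * V p.2 + lam ^ 2 * (κ * massForm w p.2))))
        * ((V p.2 + 2 * lam * (κ * massForm w p.2)) * g p.2))) volume := fun lam =>
    hJm.mul (((hexpc lam).neg.mul ((((hV.1.comp continuous_snd)).add (continuous_const.mul
      (continuous_const.mul (hQ.1.comp continuous_snd)))).mul (hg.1.comp continuous_snd))).aestronglyMeasurable)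
  have hVQg : ExpGrowth (fun φ : Cfg P j N => (|V φ| + 2 * |κ| * massForm w φ) * |g φ|) :=
    ((expGrowth_abs hV).add (hQ.const_mul (2 * |κ|))).mul (expGrowth_abs hg)
  have hmaj : Integrable (fun p : JCfg P j N => Real.exp K *
      (J C η w c (M / 2) μ2 e p * ((|V p.2| + 2 * |κ| * massForm w p.2) * |g p.2|))) :=
    (integrable_J_mul C η w c (M / 2) μ2 hw (half_pos hM) hμ hVQg e).const_mul _
  have hs : Set.Ioo (lam0 / 2) L ∈ 𝓝 lam0 := Ioo_mem_nhds (by linarith) hlamL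
  have hint := integrable_momentJ C η w c μ2 hw hM hμ hV hK hVK hg (κ := κ) hlam0.le (by linarith)
    (le_trans (mul_le_mul_of_nonneg_right hlamL.le (abs_nonneg κ)) hLκ) e
  have h := hasDerivAt_integral_of_dominated_loc_of_deriv_le (μ := volume)
    (bound := fun p : JCfg P j N => Real.exp K *
      (J C η w c (M / 2) μ2 e p * ((|V p.2| + 2 * |κ| * massForm w p.2) * |g p.2|)))
    (F := fun lam (p : JCfg P j N) => J C η w c M μ2 e p *
      (Real.exp (-(lam * V p.2 + lam ^ 2 * (κ * massForm w p.2))) * g p.2))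
    (F' := fun lam (p : JCfg P j N) => J C η w c M μ2 e p *
      (-(Real.exp (-(lam * V p.2 + lam ^ 2 * (κ * massForm w p.2))))
        * ((V p.2 + 2 * lam * (κ * massForm w p.2)) * g p.2))) hs
    (Filter.Eventually.of_forall fun lam => hmeas lam) hint (hmeas' lam0) ?_ hmaj ?_
  · have e1 : (∫ p : JCfg P j N, J C η w c M μ2 e p *
        (-(Real.exp (-(lam0 * V p.2 + lam0 ^ 2 * (κ * massForm w p.2))))
          * ((V p.2 + 2 * lam0 * (κ * massForm w p.2)) * g p.2)))
        = -(∫ p : JCfg P j N, J C η w c M μ2 e p * (Real.exp (-(lam0 * V p.2 + lam0 ^ 2 * (κ * massForm w p.2)))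
            * ((V p.2 + 2 * lam0 * (κ * massForm w p.2)) * g p.2))) := by
      rw [← integral_neg]
      exact integral_congr_ae (Filter.Eventually.of_forall fun p => by ring)
    rw [← e1]
    exact h.2
  · refine Filter.Eventually.of_forall fun p lam hlam => ?_
    obtain ⟨hlaml, hlamu⟩ := hlam
    have hl0 : 0 ≤ lam := by linarith
    have hl1 : lam ≤ 1 := by linarith
    have hlκ : lam * |κ| ≤ M / 4 := le_trans (mul_le_mul_of_nonneg_right hlamu.le (abs_nonneg κ)) hLκ
    have hexp := exp_neg_exponent_le w hw.le M hK hVK (κ := κ) hl0 hl1 hlκ p.2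
    have hJpos : 0 < J C η w c M μ2 e p := J_pos₀ C η w c μ2 M e p
    have hQ0 : 0 ≤ massForm w p.2 := massForm_nonneg hw.le p.2
    have hfac : |V p.2 + 2 * lam * (κ * massForm w p.2)| ≤ |V p.2| + 2 * |κ| * massForm w p.2 := by
      have e1 : |2 * lam * (κ * massForm w p.2)| = 2 * lam * (|κ| * massForm w p.2) := by
        rw [show 2 * lam * (κ * massForm w p.2) = (2 * lam * massForm w p.2) * κ by ring, abs_mul,
          abs_of_nonneg (mul_nonneg (mul_nonneg zero_le_two hl0) hQ0)]
        ring
      calc |V p.2 + 2 * lam * (κ * massForm w p.2)| ≤ |V p.2| + |2 * lam * (κ * massForm w p.2)| := abs_add_le _ _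
        _ = |V p.2| + 2 * lam * (|κ| * massForm w p.2) := by rw [e1]
        _ ≤ |V p.2| + 2 * 1 * (|κ| * massForm w p.2) := by
            have : 0 ≤ |κ| * massForm w p.2 := mul_nonneg (abs_nonneg κ) hQ0
            nlinarith
        _ = |V p.2| + 2 * |κ| * massForm w p.2 := by ring
    rw [Real.norm_eq_abs, abs_mul, abs_mul, abs_neg, abs_mul, abs_of_pos hJpos, abs_of_pos (Real.exp_pos _)]
    calc J C η w c M μ2 e p * (Real.exp (-(lam * V p.2 + lam ^ 2 * (κ * massForm w p.2))) *
          (|V p.2 + 2 * lam * (κ * massForm w p.2)| * |g p.2|))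
        ≤ J C η w c M μ2 e p * ((Real.exp K * Real.exp (M / 4 * massForm w p.2)) *
            ((|V p.2| + 2 * |κ| * massForm w p.2) * |g p.2|)) := by
          refine mul_le_mul_of_nonneg_left ?_ hJpos.le
          exact mul_le_mul hexp (mul_le_mul_of_nonneg_right hfac (abs_nonneg _))
            (mul_nonneg (abs_nonneg _) (abs_nonneg _)) (by positivity)
      _ = Real.exp K * (J C η w c (M / 2) μ2 e p * ((|V p.2| + 2 * |κ| * massForm w p.2) * |g p.2|)) := by
          rw [← J_mul_exp_quarter_mass C η w c μ2 M e p]; ring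
  · refine Filter.Eventually.of_forall fun p lam _ => ?_
    have h2 := hasDerivAt_exp_exponent w V κ p.2 lam
    refine ((h2.mul_const (g p.2)).const_mul (J C η w c M μ2 e p)).congr_deriv ?_
    ring

omit m2 in
/-- ONE-SIDED DIFFERENTIATION UNDER `∫dA dφ` AT `λ = 0⁺`: `λ ↦ ∫Je^{−(λV+λ²κQ)}g` (`λ ≥ 0`) has right-derivative `−∫JVg` at `0`
(dominated convergence of the difference quotients on the window). [cite: Balaban1983Higgs3, (1.19)–(1.21) p.416, (1.24) p.417]
[cite: GlimmJaffeQP1987, §8.4–8.5] -/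
private theorem hasDerivWithinAt_momentJ_zero (hw : 0 < w) {M : ℝ} (hM : 0 < M) (hμ : 0 < μ2) {V g : Cfg P j N → ℝ}
    (hV : ExpGrowth V) {K : ℝ} (hK : 0 ≤ K) (hVK : ∀ φ, -K ≤ V φ) (hg : ExpGrowth g) {κ L : ℝ} (hL0 : 0 < L) (hL1 : L ≤ 1)
    (hLκ : L * |κ| ≤ M / 4) (e : ℝ) :
    HasDerivWithinAt (fun lam : ℝ => ∫ p : JCfg P j N, J C η w c M μ2 e p *
        (Real.exp (-(lam * V p.2 + lam ^ 2 * (κ * massForm w p.2))) * g p.2))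
      (-(∫ p : JCfg P j N, J C η w c M μ2 e p * (V p.2 * g p.2))) (Set.Ici 0) 0 := by
  have hQ := B3Eq123RenormalizationConditions.expGrowth_massForm (P := P) (j := j) (N := N) w
  have hJg : Integrable (fun p : JCfg P j N => J C η w c M μ2 e p * g p.2) := integrable_J_mul C η w c M μ2 hw hM hμ hg e
  have hIlam : ∀ lam : ℝ, 0 ≤ lam → lam < L →
      Integrable (fun p : JCfg P j N => J C η w c M μ2 e p *
        (Real.exp (-(lam * V p.2 + lam ^ 2 * (κ * massForm w p.2))) * g p.2)) :=
    fun lam h0 hL => integrable_momentJ C η w c μ2 hw hM hμ hV hK hVK hg (κ := κ) h0 (by linarith)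
      (le_trans (mul_le_mul_of_nonneg_right hL.le (abs_nonneg κ)) hLκ) e
  have hI : Set.Ici (0 : ℝ) \ {0} = Set.Ioi 0 := by
    ext t
    simp only [Set.mem_sdiff, Set.mem_Ici, Set.mem_singleton_iff, Set.mem_Ioi]
    exact ⟨fun h => lt_of_le_of_ne h.1 (Ne.symm h.2), fun h => ⟨h.le, h.ne'⟩⟩
  have hpt : ∀ (lam : ℝ) (p : JCfg P j N),
      (J C η w c M μ2 e p * (Real.exp (-(lam * V p.2 + lam ^ 2 * (κ * massForm w p.2))) * g p.2)
          - J C η w c M μ2 e p * g p.2) / lam =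
        J C η w c M μ2 e p * (g p.2 * ((Real.exp (-(lam * V p.2 + lam ^ 2 * (κ * massForm w p.2))) - 1) / lam)) :=
    fun lam p => by rw [div_eq_mul_inv, div_eq_mul_inv]; ring
  rw [hasDerivWithinAt_iff_tendsto_slope, hI]
  have hsmall : Set.Ioo (0 : ℝ) L ∈ 𝓝[Set.Ioi (0 : ℝ)] 0 := Ioo_mem_nhdsGT hL0
  have hslope : ∀ lam : ℝ, 0 < lam → lam < L →
      slope (fun lam : ℝ => ∫ p : JCfg P j N, J C η w c M μ2 e p *
          (Real.exp (-(lam * V p.2 + lam ^ 2 * (κ * massForm w p.2))) * g p.2)) 0 lam =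
        ∫ p : JCfg P j N, J C η w c M μ2 e p *
          (g p.2 * ((Real.exp (-(lam * V p.2 + lam ^ 2 * (κ * massForm w p.2))) - 1) / lam)) := by
    intro lam hlam hlamL
    rw [slope_def_field, sub_zero, momentJ_zero]
    rw [← integral_sub (hIlam lam hlam.le hlamL) hJg, ← integral_div]
    exact integral_congr_ae (Filter.Eventually.of_forall fun p => hpt lam p)
  have hev : (fun lam => ∫ p : JCfg P j N, J C η w c M μ2 e p *
        (g p.2 * ((Real.exp (-(lam * V p.2 + lam ^ 2 * (κ * massForm w p.2))) - 1) / lam)))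
      =ᶠ[𝓝[Set.Ioi (0 : ℝ)] 0]
      slope (fun lam : ℝ => ∫ p : JCfg P j N, J C η w c M μ2 e p *
        (Real.exp (-(lam * V p.2 + lam ^ 2 * (κ * massForm w p.2))) * g p.2)) 0 :=
    Filter.mem_of_superset hsmall fun lam hlam => (hslope lam hlam.1 hlam.2).symm
  refine Filter.Tendsto.congr' hev ?_
  have hlim : (-(∫ p : JCfg P j N, J C η w c M μ2 e p * (V p.2 * g p.2))) =
      ∫ p : JCfg P j N, J C η w c M μ2 e p * (g p.2 * (-V p.2)) := by
    rw [← integral_neg]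
    exact integral_congr_ae (Filter.Eventually.of_forall fun p => by ring)
  rw [hlim]
  have hVQg : ExpGrowth (fun φ : Cfg P j N => (|V φ| + |κ| * massForm w φ) * |g φ|) :=
    ((expGrowth_abs hV).add (hQ.const_mul |κ|)).mul (expGrowth_abs hg)
  have hmaj : Integrable (fun p : JCfg P j N => Real.exp K *
      (J C η w c (M / 2) μ2 e p * ((|V p.2| + |κ| * massForm w p.2) * |g p.2|))) :=
    (integrable_J_mul C η w c (M / 2) μ2 hw (half_pos hM) hμ hVQg e).const_mul _
  refine tendsto_integral_filter_of_dominated_convergence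
    (fun p : JCfg P j N => Real.exp K * (J C η w c (M / 2) μ2 e p * ((|V p.2| + |κ| * massForm w p.2) * |g p.2|)))
    ?_ ?_ hmaj ?_
  · filter_upwards [hsmall] with lam hlam
    exact (((hIlam lam hlam.1.le hlam.2).sub hJg).div_const lam).aestronglyMeasurable.congr
      (Filter.Eventually.of_forall fun p => hpt lam p)
  · filter_upwards [hsmall] with lam hlam'
    obtain ⟨hlam, hlamL⟩ := hlam'
    refine Filter.Eventually.of_forall fun p => ?_
    have hl1 : lam ≤ 1 := by linarith
    have hlκ : lam * |κ| ≤ M / 4 := le_trans (mul_le_mul_of_nonneg_right hlamL.le (abs_nonneg κ)) hLκ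
    have hexp := exp_neg_exponent_le w hw.le M hK hVK (κ := κ) hlam.le hl1 hlκ p.2
    have hJpos : 0 < J C η w c M μ2 e p := J_pos₀ C η w c μ2 M e p
    have hQ0 : 0 ≤ massForm w p.2 := massForm_nonneg hw.le p.2
    have hmax : max 1 (Real.exp (-(lam * V p.2 + lam ^ 2 * (κ * massForm w p.2))))
        ≤ Real.exp K * Real.exp (M / 4 * massForm w p.2) := by
      refine max_le ?_ hexp
      have h1 : 1 ≤ Real.exp K := Real.one_le_exp hK
      have h2 : 1 ≤ Real.exp (M / 4 * massForm w p.2) := Real.one_le_exp (by positivity)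
      nlinarith
    have hq : |(Real.exp (-(lam * V p.2 + lam ^ 2 * (κ * massForm w p.2))) - 1) / lam|
        ≤ (|V p.2| + |κ| * massForm w p.2) * (Real.exp K * Real.exp (M / 4 * massForm w p.2)) := by
      rw [abs_div, abs_of_pos hlam, div_le_iff₀ hlam]
      have hu := abs_exp_neg_sub_one_le_max (lam * V p.2 + lam ^ 2 * (κ * massForm w p.2))
      have hul : |lam * V p.2 + lam ^ 2 * (κ * massForm w p.2)| ≤ lam * (|V p.2| + |κ| * massForm w p.2) := by
        calc |lam * V p.2 + lam ^ 2 * (κ * massForm w p.2)|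
            ≤ |lam * V p.2| + |lam ^ 2 * (κ * massForm w p.2)| := abs_add_le _ _
          _ = lam * |V p.2| + lam ^ 2 * (|κ| * massForm w p.2) := by
              rw [abs_mul, abs_mul, abs_mul, abs_of_pos hlam, abs_of_nonneg (sq_nonneg lam), abs_of_nonneg hQ0]
          _ ≤ lam * |V p.2| + lam * (|κ| * massForm w p.2) := by
              have h0 : 0 ≤ |κ| * massForm w p.2 := mul_nonneg (abs_nonneg κ) hQ0
              have h2 : lam ^ 2 * (|κ| * massForm w p.2) ≤ lam * (|κ| * massForm w p.2) :=
                mul_le_mul_of_nonneg_right (by nlinarith) h0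
              linarith
          _ = lam * (|V p.2| + |κ| * massForm w p.2) := by ring
      have hm0 : 0 ≤ max 1 (Real.exp (-(lam * V p.2 + lam ^ 2 * (κ * massForm w p.2)))) :=
        le_trans zero_le_one (le_max_left _ _)
      calc |Real.exp (-(lam * V p.2 + lam ^ 2 * (κ * massForm w p.2))) - 1|
          ≤ |lam * V p.2 + lam ^ 2 * (κ * massForm w p.2)| *
              max 1 (Real.exp (-(lam * V p.2 + lam ^ 2 * (κ * massForm w p.2)))) := hu
        _ ≤ (lam * (|V p.2| + |κ| * massForm w p.2)) * (Real.exp K * Real.exp (M / 4 * massForm w p.2)) :=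
            mul_le_mul hul hmax hm0 (by positivity)
        _ = (|V p.2| + |κ| * massForm w p.2) * (Real.exp K * Real.exp (M / 4 * massForm w p.2)) * lam := by ring
    rw [Real.norm_eq_abs, abs_mul, abs_mul, abs_of_pos hJpos]
    calc J C η w c M μ2 e p * (|g p.2| * |(Real.exp (-(lam * V p.2 + lam ^ 2 * (κ * massForm w p.2))) - 1) / lam|)
        ≤ J C η w c M μ2 e p * (|g p.2| * ((|V p.2| + |κ| * massForm w p.2) *
            (Real.exp K * Real.exp (M / 4 * massForm w p.2)))) :=
          mul_le_mul_of_nonneg_left (mul_le_mul_of_nonneg_left hq (abs_nonneg _)) hJpos.le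
      _ = Real.exp K * (J C η w c (M / 2) μ2 e p * ((|V p.2| + |κ| * massForm w p.2) * |g p.2|)) := by
          rw [← J_mul_exp_quarter_mass C η w c μ2 M e p]; ring
  · refine Filter.Eventually.of_forall fun p => ?_
    have hd : HasDerivAt (fun lam : ℝ => Real.exp (-(lam * V p.2 + lam ^ 2 * (κ * massForm w p.2)))) (-V p.2) 0 := by
      have h := hasDerivAt_exp_exponent w V κ p.2 0
      refine h.congr_deriv ?_
      simp
    have ht : Tendsto (slope (fun lam : ℝ => Real.exp (-(lam * V p.2 + lam ^ 2 * (κ * massForm w p.2)))) 0)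
        (𝓝[Set.Ioi (0:ℝ)] 0) (𝓝 (-V p.2)) := by
      have h := hasDerivAt_iff_tendsto_slope.mp hd
      exact h.mono_left (nhdsWithin_mono _ fun t (ht : 0 < t) => ne_of_gt ht)
    have ht' : Tendsto (fun lam : ℝ => (Real.exp (-(lam * V p.2 + lam ^ 2 * (κ * massForm w p.2))) - 1) / lam)
        (𝓝[Set.Ioi (0:ℝ)] 0) (𝓝 (-V p.2)) := by
      refine ht.congr' (eventually_nhdsWithin_of_forall fun lam hlam => ?_)
      rw [slope_def_field, sub_zero]
      simp
    exact (ht'.const_mul (g p.2)).const_mul (J C η w c M μ2 e p)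

omit m2 in
/-- the moments on the whole window `0 ≤ λ₀ < L`: right-derivative within `[0,∞)`. [cite: Balaban1983Higgs3, (1.19)–(1.21) p.416]
[cite: GlimmJaffeQP1987, §8.4–8.5] -/
private theorem hasDerivWithinAt_momentJ (hw : 0 < w) {M : ℝ} (hM : 0 < M) (hμ : 0 < μ2) {V g : Cfg P j N → ℝ}
    (hV : ExpGrowth V) {K : ℝ} (hK : 0 ≤ K) (hVK : ∀ φ, -K ≤ V φ) (hg : ExpGrowth g) {κ L lam0 : ℝ} (hL1 : L ≤ 1)
    (hLκ : L * |κ| ≤ M / 4) (hlam0 : 0 ≤ lam0) (hlamL : lam0 < L) (e : ℝ) :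
    HasDerivWithinAt (fun lam : ℝ => ∫ p : JCfg P j N, J C η w c M μ2 e p *
        (Real.exp (-(lam * V p.2 + lam ^ 2 * (κ * massForm w p.2))) * g p.2))
      (-(∫ p : JCfg P j N, J C η w c M μ2 e p * (Real.exp (-(lam0 * V p.2 + lam0 ^ 2 * (κ * massForm w p.2)))
        * ((V p.2 + 2 * lam0 * (κ * massForm w p.2)) * g p.2)))) (Set.Ici 0) lam0 := by
  rcases hlam0.eq_or_lt with h | h
  · subst h
    have h0 := hasDerivWithinAt_momentJ_zero C η w c μ2 hw hM hμ hV hK hVK hg (κ := κ) hlamL hL1 hLκ e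
    refine h0.congr_deriv ?_
    congr 1
    refine integral_congr_ae (Filter.Eventually.of_forall fun p => ?_)
    show J C η w c M μ2 e p * (V p.2 * g p.2) = J C η w c M μ2 e p *
      (Real.exp (-(0 * V p.2 + 0 ^ 2 * (κ * massForm w p.2))) * ((V p.2 + 2 * 0 * (κ * massForm w p.2)) * g p.2))
    simp
  · exact (hasDerivAt_momentJ C η w c μ2 hw hM hμ hV hK hVK hg hL1 hLκ h hlamL e).hasDerivWithinAt

omit m2 in
/-- the normalization `N_1(λ) = ∫Je^{−(λV+λ²κQ)} > 0` on the window. [cite: Balaban1983Higgs3, (1.19) p.416] -/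
private theorem momentJ_one_pos (hw : 0 < w) {M : ℝ} (hM : 0 < M) (hμ : 0 < μ2) {V : Cfg P j N → ℝ} (hV : ExpGrowth V)
    {K : ℝ} (hK : 0 ≤ K) (hVK : ∀ φ, -K ≤ V φ) {κ lam : ℝ} (hlam0 : 0 ≤ lam) (hlam1 : lam ≤ 1) (hlamκ : lam * |κ| ≤ M / 4)
    (e : ℝ) :
    0 < ∫ p : JCfg P j N, J C η w c M μ2 e p *
      (Real.exp (-(lam * V p.2 + lam ^ 2 * (κ * massForm w p.2))) * 1) := by
  have hi := integrable_momentJ C η w c μ2 hw hM hμ hV hK hVK (ExpGrowth.const 1) (κ := κ) hlam0 hlam1 hlamκ e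
  have hptw : ∀ p : JCfg P j N, 0 < J C η w c M μ2 e p *
      (Real.exp (-(lam * V p.2 + lam ^ 2 * (κ * massForm w p.2))) * 1) := fun p =>
    mul_pos (J_pos₀ C η w c μ2 M e p) (by rw [mul_one]; exact Real.exp_pos _)
  rw [integral_pos_iff_support_of_nonneg (fun p => (hptw p).le) hi]
  have hsupp : Function.support (fun p : JCfg P j N => J C η w c M μ2 e p *
      (Real.exp (-(lam * V p.2 + lam ^ 2 * (κ * massForm w p.2))) * 1)) = Set.univ :=
    Set.eq_univ_iff_forall.mpr fun p => Function.mem_support.mpr (hptw p).ne'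
  rw [hsupp, Measure.volume_eq_prod, ← Set.univ_prod_univ, Measure.prod_prod]
  exact ENNReal.mul_pos (isOpen_univ.measure_pos volume Set.univ_nonempty).ne'
    (isOpen_univ.measure_pos volume Set.univ_nonempty).ne'

omit m2 in
/-- linearity: `∫Je^{−E}(V + 2λκQ)g = ∫Je^{−E}Vg + 2λκ∫Je^{−E}Qg` on the window. [cite: Balaban1983Higgs3, (1.19) p.416] -/
private theorem momentJ_split (hw : 0 < w) {M : ℝ} (hM : 0 < M) (hμ : 0 < μ2) {V g : Cfg P j N → ℝ} (hV : ExpGrowth V)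
    {K : ℝ} (hK : 0 ≤ K) (hVK : ∀ φ, -K ≤ V φ) (hg : ExpGrowth g) {κ lam : ℝ} (hlam0 : 0 ≤ lam) (hlam1 : lam ≤ 1)
    (hlamκ : lam * |κ| ≤ M / 4) (e : ℝ) :
    (∫ p : JCfg P j N, J C η w c M μ2 e p * (Real.exp (-(lam * V p.2 + lam ^ 2 * (κ * massForm w p.2))) *
        ((V p.2 + 2 * lam * (κ * massForm w p.2)) * g p.2)))
      = (∫ p : JCfg P j N, J C η w c M μ2 e p * (Real.exp (-(lam * V p.2 + lam ^ 2 * (κ * massForm w p.2))) *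
          (V p.2 * g p.2)))
        + 2 * lam * κ * ∫ p : JCfg P j N, J C η w c M μ2 e p *
          (Real.exp (-(lam * V p.2 + lam ^ 2 * (κ * massForm w p.2))) * (massForm w p.2 * g p.2)) := by
  have hQ := B3Eq123RenormalizationConditions.expGrowth_massForm (P := P) (j := j) (N := N) w
  have i1 := integrable_momentJ C η w c μ2 hw hM hμ hV hK hVK (hV.mul hg) (κ := κ) hlam0 hlam1 hlamκ e
  have i2 := integrable_momentJ C η w c μ2 hw hM hμ hV hK hVK (hQ.mul hg) (κ := κ) hlam0 hlam1 hlamκ e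
  rw [← integral_const_mul, ← integral_add i1 (i2.const_mul _)]
  exact integral_congr_ae (Filter.Eventually.of_forall fun p => by ring)

end MomentsJ


/-! ## §6 THE SECOND RIGHT-DERIVATIVE OF `log N_1` AT `λ = 0⁺` AT ANY CHARGE — one-variable calculus on the window
(`(log M)″ = (M″M − M′²)/M²`) fed with §5: `N_1′ = −[N_V + 2λκN_Q]`, `N_1″(0⁺) = N_{V²}(0) − 2κN_Q(0)`: for every `V ≥ −K` of
exponential-linear growth, every `κ`, every charge `e` and mass `M > 0`,
`iteratedDerivWithin 2 (λ ↦ log∫dA dφ e^{−S^ε_{e,M}}e^{−(λV+λ²κQ)}) [0,∞) 0 = Var_{e,M}(V) − 2κ⟨Q⟩_{e,M}` -/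

section SecondOrder

omit C η w c m2 μ2 in
/-- **calculus lemma**: if `M > 0` has derivative `M′` within `[0,∞)` on `[0,L)` and `M′` has the right-derivative `c` at `0`,
then `iteratedDerivWithin 2 (log∘M) [0,∞) 0 = (c·M(0) − M′(0)²)/M(0)²`. [folklore] -/
private theorem iteratedDerivWithin_two_log {M M' : ℝ → ℝ} {cc L : ℝ} (hL : 0 < L)
    (hpos : ∀ x : ℝ, 0 ≤ x → x < L → 0 < M x) (h1 : ∀ x : ℝ, 0 ≤ x → x < L → HasDerivWithinAt M (M' x) (Set.Ici 0) x)
    (h2 : HasDerivWithinAt M' cc (Set.Ici 0) 0) :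
    iteratedDerivWithin 2 (fun x => Real.log (M x)) (Set.Ici 0) 0 = (cc * M 0 - M' 0 * M' 0) / M 0 ^ 2 := by
  have hA : ∀ x : ℝ, 0 ≤ x → x < L →
      HasDerivWithinAt (fun x => Real.log (M x)) (M' x / M x) (Set.Ici 0) x :=
    fun x hx0 hxL => (h1 x hx0 hxL).log (hpos x hx0 hxL).ne'
  have hB : ∀ x : ℝ, 0 ≤ x → x < L → derivWithin (fun x => Real.log (M x)) (Set.Ici 0) x = M' x / M x :=
    fun x hx0 hxL => (hA x hx0 hxL).derivWithin (uniqueDiffOn_Ici (0 : ℝ) x hx0)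
  have hwin : derivWithin (fun x => Real.log (M x)) (Set.Ici 0) =ᶠ[𝓝[Set.Ici (0 : ℝ)] 0] fun x => M' x / M x := by
    filter_upwards [Ico_mem_nhdsGE hL] with x hx
    exact hB x hx.1 hx.2
  have hM0 : M 0 ≠ 0 := (hpos 0 le_rfl hL).ne'
  have hC : HasDerivWithinAt (fun x => M' x / M x) ((cc * M 0 - M' 0 * M' 0) / M 0 ^ 2) (Set.Ici 0) 0 :=
    h2.div (h1 0 le_rfl hL) hM0
  rw [show (2 : ℕ) = 1 + 1 from rfl, iteratedDerivWithin_succ, iteratedDerivWithin_one,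
    hwin.derivWithin_eq_of_mem Set.self_mem_Ici, hC.derivWithin (uniqueDiffOn_Ici (0 : ℝ) 0 Set.self_mem_Ici)]

omit m2 in
/-- **THE SECOND RIGHT-DERIVATIVE OF `log∫dA dφ e^{−S^ε_{e,M}}e^{−(λV+λ²κQ)}` AT `λ = 0⁺`**, for every interaction `V ≥ −K` of
exponential-linear growth, every `κ`, every charge `e`, mass `M > 0`: in Mathlib's spelling,
`iteratedDerivWithin 2 (λ ↦ log∫Je^{−(λV+λ²κQ)}) (Set.Ici 0) 0 = [(∫JV² − 2κ∫JQ)·∫J − (∫JV)²]/(∫J)²` = `Var(V) − 2κ⟨Q⟩` in the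
measure `∫dA dφ e^{−S^ε_{e,M}}(·)/∫dA dφ e^{−S^ε_{e,M}}` — second-order perturbation theory in `λ` at fixed charge (`N_1″(0⁺) =
∫JV² − 2κ∫JQ`, `N_1′(0) = −∫JV`). [cite: Balaban1983Higgs3, (1.20) p.416, (1.24) p.417] [cite: GlimmJaffeQP1987, §8.4–8.5] -/
theorem iteratedDerivWithin_two_logMomentJ (hw : 0 < w) {M : ℝ} (hM : 0 < M) (hμ : 0 < μ2) {V : Cfg P j N → ℝ}
    (hV : ExpGrowth V) {K : ℝ} (hK : 0 ≤ K) (hVK : ∀ φ, -K ≤ V φ) (κ e : ℝ) :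
    iteratedDerivWithin 2
        (fun lam : ℝ => Real.log (∫ p : JCfg P j N, J C η w c M μ2 e p *
          (Real.exp (-(lam * V p.2 + lam ^ 2 * (κ * massForm w p.2))) * 1))) (Set.Ici 0) 0
      = (((∫ p : JCfg P j N, J C η w c M μ2 e p * V p.2 ^ 2) - 2 * κ * ∫ p : JCfg P j N, J C η w c M μ2 e p * massForm w p.2)
            * (∫ p : JCfg P j N, J C η w c M μ2 e p)
          - (∫ p : JCfg P j N, J C η w c M μ2 e p * V p.2) ^ 2) / (∫ p : JCfg P j N, J C η w c M μ2 e p) ^ 2 := by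
  obtain ⟨L, hL0, hL1, hLκ⟩ := exists_window hM κ
  have hQ := B3Eq123RenormalizationConditions.expGrowth_massForm (P := P) (j := j) (N := N) w
  have h1g := ExpGrowth.const (P := P) (j := j) (N := N) (1 : ℝ)
  have hwin : ∀ x : ℝ, 0 ≤ x → x < L → x ≤ 1 ∧ x * |κ| ≤ M / 4 := fun x hx0 hxL =>
    ⟨hxL.le.trans hL1, (mul_le_mul_of_nonneg_right hxL.le (abs_nonneg κ)).trans hLκ⟩
  set Mf : ℝ → ℝ := fun lam => ∫ p : JCfg P j N, J C η w c M μ2 e p *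
    (Real.exp (-(lam * V p.2 + lam ^ 2 * (κ * massForm w p.2))) * 1) with hMdef
  set MV : ℝ → ℝ := fun lam => ∫ p : JCfg P j N, J C η w c M μ2 e p *
    (Real.exp (-(lam * V p.2 + lam ^ 2 * (κ * massForm w p.2))) * (V p.2 * 1)) with hMVdef
  set MQ : ℝ → ℝ := fun lam => ∫ p : JCfg P j N, J C η w c M μ2 e p *
    (Real.exp (-(lam * V p.2 + lam ^ 2 * (κ * massForm w p.2))) * (massForm w p.2 * 1)) with hMQdef
  set M' : ℝ → ℝ := fun lam => -(MV lam + 2 * lam * κ * MQ lam) with hM'def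
  have dM : ∀ x : ℝ, 0 ≤ x → x < L → HasDerivWithinAt Mf (M' x) (Set.Ici 0) x := by
    intro x hx0 hxL
    have h := hasDerivWithinAt_momentJ C η w c μ2 hw hM hμ hV hK hVK h1g (κ := κ) hL1 hLκ hx0 hxL e
    refine h.congr_deriv ?_
    rw [momentJ_split C η w c μ2 hw hM hμ hV hK hVK h1g hx0 (hwin x hx0 hxL).1 (hwin x hx0 hxL).2 e]
  have dMV0 := hasDerivWithinAt_momentJ_zero C η w c μ2 hw hM hμ hV hK hVK (hV.mul h1g) (κ := κ) hL0 hL1 hLκ e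
  have dMQ0 := hasDerivWithinAt_momentJ_zero C η w c μ2 hw hM hμ hV hK hVK (hQ.mul h1g) (κ := κ) hL0 hL1 hLκ e
  have hlin0 : HasDerivWithinAt (fun lam : ℝ => 2 * lam * κ) (2 * κ) (Set.Ici 0) 0 := by
    have h := ((hasDerivAt_id (0 : ℝ)).const_mul 2).mul_const κ
    simpa using h.hasDerivWithinAt
  have dM' : HasDerivWithinAt M'
      (-(-(∫ p : JCfg P j N, J C η w c M μ2 e p * (V p.2 * (V p.2 * 1))) + (2 * κ * MQ 0 + 2 * 0 * κ *
        -(∫ p : JCfg P j N, J C η w c M μ2 e p * (V p.2 * (massForm w p.2 * 1)))))) (Set.Ici 0) 0 := by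
    have h := (dMV0.add (hlin0.mul dMQ0)).neg
    refine h.congr_deriv ?_
    ring
  have hposM : ∀ x : ℝ, 0 ≤ x → x < L → 0 < Mf x := fun x hx0 hxL =>
    momentJ_one_pos C η w c μ2 hw hM hμ hV hK hVK (κ := κ) hx0 (hwin x hx0 hxL).1 (hwin x hx0 hxL).2 e
  rw [iteratedDerivWithin_two_log (M := Mf) (M' := M') hL0 hposM dM dM']
  have eM : Mf 0 = ∫ p : JCfg P j N, J C η w c M μ2 e p := by
    simp only [hMdef]; exact integral_congr_ae (Filter.Eventually.of_forall fun p => by simp)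
  have eMV : MV 0 = ∫ p : JCfg P j N, J C η w c M μ2 e p * V p.2 := by
    simp only [hMVdef]; exact integral_congr_ae (Filter.Eventually.of_forall fun p => by simp)
  have eMQ : MQ 0 = ∫ p : JCfg P j N, J C η w c M μ2 e p * massForm w p.2 := by
    simp only [hMQdef]; exact integral_congr_ae (Filter.Eventually.of_forall fun p => by simp)
  have eV2 : (∫ p : JCfg P j N, J C η w c M μ2 e p * (V p.2 * (V p.2 * 1))) =
      ∫ p : JCfg P j N, J C η w c M μ2 e p * V p.2 ^ 2 :=
    integral_congr_ae (Filter.Eventually.of_forall fun p => by simp only [mul_one]; ring)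
  have eM' : M' 0 = -(∫ p : JCfg P j N, J C η w c M μ2 e p * V p.2) := by
    simp only [hM'def]; rw [eMV]; ring
  rw [eM, eM', eMQ, eV2]
  ring

end SecondOrder


/-! ## §7 `log Z^{ct}(e,λ)` WITH PRINT'S FULL COUNTERTERM SERIES OF WEIGHT `α + 2β ≤ 4` INSERTED: `δm²(e,λ) = δm²_{(2,0)}e² +
δm²_{(0,1)}λ + δm²_{(2,1)}e²λ + δm²_{(0,2)}λ² + δm²_{(2,2)}e²λ² + δm²_{(4,0)}e⁴` (the letters `d20, d01, d21, d02, d22, d40`),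
`Z^{ct}(e,λ) = ∫dA dφ e^{−S^ε_{e, m²+δm²(e,λ)}}e^{−λΣ_yη^d∣φ(y)∣⁴}` (`λ ≥ 0`), in the body-of-record order of `E1of124R`: at fixed
charge the `λ`-part of the counterterm is the exponent `λV_e + λ²κ_eQ` of §5 (`V_e = U + ½δm²_{(2,1)}e²Q`, `κ_e = ½(δm²_{(0,2)} +
δm²_{(2,2)}e²)`, `U = Σ_yη^d∣φ(y)∣⁴ + ½δm²_{(0,1)}Q`), so §6 gives the INNER second right-derivative at every charge `e` near `0`:
`Var_e(V_e) − (δm²_{(0,2)} + δm²_{(2,2)}e²)⟨Q⟩_e` in the measure at charge `e`, `λ = 0`, mass `M_e = m² + δm²_{(2,0)}e² + δm²_{(4,0)}e⁴` -/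

/-- **the fibre over the charge**: `∫dA dφ e^{−S^ε_{e, m²+δm²(e,λ)}}e^{−λΣη^d∣φ∣⁴} = ∫dA dφ e^{−S^ε_{e, M_e}}e^{−(λV_e + λ²κ_eQ)}` (the
counterterm is a mass shift: `e^{−S_{M+t}} = e^{−S_M}e^{−½tQ}`, `t = (δm²_{(0,1)} + δm²_{(2,1)}e²)λ + (δm²_{(0,2)} + δm²_{(2,2)}e²)λ²`).
[cite: Balaban1983Higgs3, (1.20) p.416, (1.23)–(1.24) p.417] -/
theorem Zct_fibre (d20 d01 d21 d02 d22 d40 e lam : ℝ) {U : Cfg P j N → ℝ}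
    (hU : ∀ φ, U φ = (∑ y : Site P j, w * ‖φ y‖ ^ 4) + 1 / 2 * d01 * massForm w φ) :
    (∫ p : JCfg P j N, J C η w c (m2 + (d20 * e ^ 2 + d01 * lam + d21 * (e ^ 2 * lam) + d02 * lam ^ 2
        + d22 * (e ^ 2 * lam ^ 2) + d40 * e ^ 4)) μ2 e p * Real.exp (-(lam * ∑ y : Site P j, w * ‖p.2 y‖ ^ 4))) =
      ∫ p : JCfg P j N, J C η w c (m2 + (d20 * e ^ 2 + d40 * e ^ 4)) μ2 e p *
        (Real.exp (-(lam * (U p.2 + 1 / 2 * (d21 * e ^ 2) * massForm w p.2)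
          + lam ^ 2 * (1 / 2 * (d02 + d22 * e ^ 2) * massForm w p.2))) * 1) := by
  refine integral_congr_ae (Filter.Eventually.of_forall fun p => ?_)
  have hm : m2 + (d20 * e ^ 2 + d01 * lam + d21 * (e ^ 2 * lam) + d02 * lam ^ 2 + d22 * (e ^ 2 * lam ^ 2) + d40 * e ^ 4) =
      (m2 + (d20 * e ^ 2 + d40 * e ^ 4)) + ((d01 + d21 * e ^ 2) * lam + (d02 + d22 * e ^ 2) * lam ^ 2) := by ring
  dsimp only
  rw [hm, B3Eq123RenormalizationConditions.J_mass_add C η w c (m2 + (d20 * e ^ 2 + d40 * e ^ 4)) μ2 ((d01 + d21 * e ^ 2) * lam + (d02 + d22 * e ^ 2) * lam ^ 2)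
    e p, hU, mul_one, mul_assoc, ← Real.exp_add]
  congr 1
  congr 1
  ring

/-- **THE INNER DERIVATIVE OF THE BODY OF RECORD AT ORDER `λ²`: for every charge `e` with `∣δm²_{(2,0)}e² + δm²_{(4,0)}e⁴∣ ≤ m²/2`,
`iteratedDerivWithin 2 (λ ↦ log Z^{ct}(e,λ)) [0,∞) 0 = [(I_e(V_e²) − (δm²_{(0,2)} + δm²_{(2,2)}e²)I_e(Q))·I_e(1) − I_e(V_e)²]/I_e(1)²`**,
`I_e(F) = ∫dA dφ e^{−S^ε_{e,M_e}}F` — the variance of the order-`λ` action `V_e = U + ½δm²_{(2,1)}e²Q` minus twice the order-`λ²`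
mass vertex, in the measure at charge `e` (§6 at `V = V_e`, `κ = ½(δm²_{(0,2)} + δm²_{(2,2)}e²)`). [cite: Balaban1983Higgs3, (1.20)
p.416, (1.24) p.417] [cite: GlimmJaffeQP1987, §8.4–8.5] -/
theorem iteratedDerivWithin_two_logZct (hw : 0 < w) (hm : 0 < m2) (hμ : 0 < μ2) (d20 d01 d21 d02 d22 d40 : ℝ)
    {U : Cfg P j N → ℝ} (hU : ∀ φ, U φ = (∑ y : Site P j, w * ‖φ y‖ ^ 4) + 1 / 2 * d01 * massForm w φ) {e : ℝ}
    (he : |d20 * e ^ 2 + d40 * e ^ 4| ≤ m2 / 2) :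
    iteratedDerivWithin 2 (fun lam : ℝ => Real.log (∫ p : JCfg P j N,
        J C η w c (m2 + (d20 * e ^ 2 + d01 * lam + d21 * (e ^ 2 * lam) + d02 * lam ^ 2
          + d22 * (e ^ 2 * lam ^ 2) + d40 * e ^ 4)) μ2 e p *
          Real.exp (-(lam * ∑ y : Site P j, w * ‖p.2 y‖ ^ 4)))) (Set.Ici 0) 0 =
      (((∫ p : JCfg P j N, J C η w c (m2 + (d20 * e ^ 2 + d40 * e ^ 4)) μ2 e p *
            (U p.2 + 1 / 2 * (d21 * e ^ 2) * massForm w p.2) ^ 2)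
          - (d02 + d22 * e ^ 2) * ∫ p : JCfg P j N, J C η w c (m2 + (d20 * e ^ 2 + d40 * e ^ 4)) μ2 e p * massForm w p.2)
          * (∫ p : JCfg P j N, J C η w c (m2 + (d20 * e ^ 2 + d40 * e ^ 4)) μ2 e p)
        - (∫ p : JCfg P j N, J C η w c (m2 + (d20 * e ^ 2 + d40 * e ^ 4)) μ2 e p *
            (U p.2 + 1 / 2 * (d21 * e ^ 2) * massForm w p.2)) ^ 2) /
        (∫ p : JCfg P j N, J C η w c (m2 + (d20 * e ^ 2 + d40 * e ^ 4)) μ2 e p) ^ 2 := by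
  have hfun : (fun lam : ℝ => Real.log (∫ p : JCfg P j N,
        J C η w c (m2 + (d20 * e ^ 2 + d01 * lam + d21 * (e ^ 2 * lam) + d02 * lam ^ 2
          + d22 * (e ^ 2 * lam ^ 2) + d40 * e ^ 4)) μ2 e p *
          Real.exp (-(lam * ∑ y : Site P j, w * ‖p.2 y‖ ^ 4)))) =
      fun lam => Real.log (∫ p : JCfg P j N, J C η w c (m2 + (d20 * e ^ 2 + d40 * e ^ 4)) μ2 e p *
        (Real.exp (-(lam * (fun φ : Cfg P j N => U φ + 1 / 2 * (d21 * e ^ 2) * massForm w φ) p.2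
          + lam ^ 2 * (1 / 2 * (d02 + d22 * e ^ 2) * massForm w p.2))) * 1)) := by
    funext lam; rw [Zct_fibre C η w c m2 μ2 d20 d01 d21 d02 d22 d40 e lam hU]
  have hK : (0 : ℝ) ≤ Fintype.card (Site P j) * (w * (d01 + d21 * e ^ 2) ^ 2 / 16) := by positivity
  rw [hfun, iteratedDerivWithin_two_logMomentJ C η w c μ2 hw (mass_pos' m2 hm he) hμ (B3Eq124IndexTwoOne.expGrowth_Ue w d01 d21 e hU) hK
    (B3Eq124IndexTwoOne.neg_le_Ue w hw.le d01 d21 e hU) (1 / 2 * (d02 + d22 * e ^ 2)) e]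
  ring

omit C η w c m2 μ2 in
/-- the `λ = 0` counterterm curve `c(e) = δm²_{(2,0)}e² + δm²_{(4,0)}e⁴` (= BRICK 16's private lemma). [folklore] -/
private theorem hasDerivAt_c20 (d20 d40 e : ℝ) :
    HasDerivAt (fun s : ℝ => d20 * s ^ 2 + d40 * s ^ 4) (2 * d20 * e + 4 * d40 * e ^ 3) e := by
  have h := ((hasDerivAt_pow 2 e).const_mul d20).add ((hasDerivAt_pow 4 e).const_mul d40)
  refine h.congr_deriv ?_
  simp only [Nat.cast_ofNat]
  ring

omit C η w c m2 μ2 in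
/-- `c′(e) = 2δm²_{(2,0)}e + 4δm²_{(4,0)}e³` has derivative `c″(e) = 2δm²_{(2,0)} + 12δm²_{(4,0)}e²`. [folklore] -/
private theorem hasDerivAt_c20' (d20 d40 e : ℝ) :
    HasDerivAt (fun s : ℝ => 2 * d20 * s + 4 * d40 * s ^ 3) (2 * d20 + 12 * d40 * e ^ 2) e := by
  have h := ((hasDerivAt_id e).const_mul (2 * d20)).add ((hasDerivAt_pow 3 e).const_mul (4 * d40))
  refine h.congr_deriv ?_
  simp only [Nat.cast_ofNat]
  ring

omit C η w c μ2 in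
/-- a ball `∣e∣ < r` on which `∣c(e)∣ ≤ m²/2` and `c′, c″` are bounded. [folklore] -/
private theorem exists_ball_c20 (hm : 0 < m2) (d20 d40 : ℝ) :
    ∃ r B : ℝ, 0 < r ∧ (∀ e, |e| < r → |d20 * e ^ 2 + d40 * e ^ 4| ≤ m2 / 2) ∧
      (∀ e, |e| < r → |2 * d20 * e + 4 * d40 * e ^ 3| ≤ B) ∧ (∀ e, |e| < r → |2 * d20 + 12 * d40 * e ^ 2| ≤ B) :=
  exists_ball_bounds' m2 hm (ct := fun s => d20 * s ^ 2 + d40 * s ^ 4) (ct' := fun s => 2 * d20 * s + 4 * d40 * s ^ 3)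
    (ct'' := fun s => 2 * d20 + 12 * d40 * s ^ 2) (hasDerivAt_c20 d20 d40) (hasDerivAt_c20' d20 d40)
    (continuous_const.add (continuous_const.mul (continuous_pow 2))).continuousAt (by ring)

/-- **NEAR `e = 0` THE INNER DERIVATIVE IS A COMBINATION OF §2's QUOTIENT CURVES** `q_F(e) = N_F(e)/Z(e)` (`F₀ = 1`): on the ball
where `∣c(e)∣ ≤ m²/2`, `iteratedDerivWithin 2 (λ ↦ log Z^{ct}(e,λ)) [0,∞) 0 = q_{U²} + δm²_{(2,1)}e²·q_{UQ} + ¼δm²_{(2,1)}²e⁴·q_{Q²} −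
(δm²_{(0,2)} + δm²_{(2,2)}e²)·q_Q − (q_U + ½δm²_{(2,1)}e²·q_Q)²` — an eventual equality at `0`, which is all the outer
`iteratedDeriv 2 · 0` sees. [cite: Balaban1983Higgs3, (1.20) p.416, (1.24) p.417] -/
theorem iteratedDerivWithin_two_logZct_eventuallyEq (hw : 0 < w) (hm : 0 < m2) (hμ : 0 < μ2)
    (d20 d01 d21 d02 d22 d40 : ℝ) {U : Cfg P j N → ℝ}
    (hU : ∀ φ, U φ = (∑ y : Site P j, w * ‖φ y‖ ^ 4) + 1 / 2 * d01 * massForm w φ) :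
    (fun e : ℝ => iteratedDerivWithin 2 (fun lam : ℝ => Real.log (∫ p : JCfg P j N,
        J C η w c (m2 + (d20 * e ^ 2 + d01 * lam + d21 * (e ^ 2 * lam) + d02 * lam ^ 2
          + d22 * (e ^ 2 * lam ^ 2) + d40 * e ^ 4)) μ2 e p *
          Real.exp (-(lam * ∑ y : Site P j, w * ‖p.2 y‖ ^ 4)))) (Set.Ici 0) 0) =ᶠ[𝓝 0]
      fun e =>
        (∫ p : JCfg P j N, J C η w c (m2 + (d20 * e ^ 2 + d40 * e ^ 4)) μ2 e p * (U p.2 * U p.2)) /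
            (∫ p : JCfg P j N, J C η w c (m2 + (d20 * e ^ 2 + d40 * e ^ 4)) μ2 e p * (1 : ℝ))
          + d21 * e ^ 2 * ((∫ p : JCfg P j N, J C η w c (m2 + (d20 * e ^ 2 + d40 * e ^ 4)) μ2 e p *
              (U p.2 * massForm w p.2)) / (∫ p : JCfg P j N, J C η w c (m2 + (d20 * e ^ 2 + d40 * e ^ 4)) μ2 e p * (1 : ℝ)))
          + 1 / 4 * d21 ^ 2 * e ^ 4 * ((∫ p : JCfg P j N, J C η w c (m2 + (d20 * e ^ 2 + d40 * e ^ 4)) μ2 e p *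
              (massForm w p.2 * massForm w p.2)) /
                (∫ p : JCfg P j N, J C η w c (m2 + (d20 * e ^ 2 + d40 * e ^ 4)) μ2 e p * (1 : ℝ)))
          - (d02 + d22 * e ^ 2) * ((∫ p : JCfg P j N, J C η w c (m2 + (d20 * e ^ 2 + d40 * e ^ 4)) μ2 e p * massForm w p.2) /
              (∫ p : JCfg P j N, J C η w c (m2 + (d20 * e ^ 2 + d40 * e ^ 4)) μ2 e p * (1 : ℝ)))
          - ((∫ p : JCfg P j N, J C η w c (m2 + (d20 * e ^ 2 + d40 * e ^ 4)) μ2 e p * U p.2) /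
              (∫ p : JCfg P j N, J C η w c (m2 + (d20 * e ^ 2 + d40 * e ^ 4)) μ2 e p * (1 : ℝ))
            + 1 / 2 * d21 * e ^ 2 * ((∫ p : JCfg P j N, J C η w c (m2 + (d20 * e ^ 2 + d40 * e ^ 4)) μ2 e p *
                massForm w p.2) / (∫ p : JCfg P j N, J C η w c (m2 + (d20 * e ^ 2 + d40 * e ^ 4)) μ2 e p * (1 : ℝ)))) ^ 2 := by
  obtain ⟨r, B, hr, hc, -, -⟩ := exists_ball_c20 m2 hm d20 d40
  have h00 : |(0 : ℝ)| < r := by rwa [abs_zero]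
  refine Filter.eventually_of_mem (ball_mem_nhds' h00) fun e he => ?_
  have he' := hc e (abs_lt_of_mem_ball' he)
  dsimp only
  rw [iteratedDerivWithin_two_logZct C η w c m2 μ2 hw hm hμ d20 d01 d21 d02 d22 d40 hU he']
  have hUg := expGrowth_U w d01 hU
  have hmF := B3Eq123RenormalizationConditions.expGrowth_massForm (P := P) (j := j) (N := N) w
  have hM := mass_pos' m2 hm he'
  have iUU := integrable_J_mul C η w c (m2 + (d20 * e ^ 2 + d40 * e ^ 4)) μ2 hw hM hμ (hUg.mul hUg) e
  have iUQ := integrable_J_mul C η w c (m2 + (d20 * e ^ 2 + d40 * e ^ 4)) μ2 hw hM hμ (hUg.mul hmF) e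
  have iQQ := integrable_J_mul C η w c (m2 + (d20 * e ^ 2 + d40 * e ^ 4)) μ2 hw hM hμ (hmF.mul hmF) e
  have iU := integrable_J_mul C η w c (m2 + (d20 * e ^ 2 + d40 * e ^ 4)) μ2 hw hM hμ hUg e
  have iQ := integrable_J_mul C η w c (m2 + (d20 * e ^ 2 + d40 * e ^ 4)) μ2 hw hM hμ hmF e
  have hsq : (∫ p : JCfg P j N, J C η w c (m2 + (d20 * e ^ 2 + d40 * e ^ 4)) μ2 e p *
      (U p.2 + 1 / 2 * (d21 * e ^ 2) * massForm w p.2) ^ 2) =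
      (∫ p : JCfg P j N, J C η w c (m2 + (d20 * e ^ 2 + d40 * e ^ 4)) μ2 e p * (U p.2 * U p.2))
        + d21 * e ^ 2 * (∫ p : JCfg P j N, J C η w c (m2 + (d20 * e ^ 2 + d40 * e ^ 4)) μ2 e p *
            (U p.2 * massForm w p.2))
        + 1 / 4 * d21 ^ 2 * e ^ 4 * (∫ p : JCfg P j N, J C η w c (m2 + (d20 * e ^ 2 + d40 * e ^ 4)) μ2 e p *
            (massForm w p.2 * massForm w p.2)) := by
    have i2 : Integrable (fun p : JCfg P j N => d21 * e ^ 2 * (J C η w c (m2 + (d20 * e ^ 2 + d40 * e ^ 4)) μ2 e p *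
        (U p.2 * massForm w p.2))) := iUQ.const_mul _
    have i3 : Integrable (fun p : JCfg P j N => 1 / 4 * d21 ^ 2 * e ^ 4 *
        (J C η w c (m2 + (d20 * e ^ 2 + d40 * e ^ 4)) μ2 e p * (massForm w p.2 * massForm w p.2))) := iQQ.const_mul _
    have i23 : Integrable (fun p : JCfg P j N => d21 * e ^ 2 * (J C η w c (m2 + (d20 * e ^ 2 + d40 * e ^ 4)) μ2 e p *
        (U p.2 * massForm w p.2)) + 1 / 4 * d21 ^ 2 * e ^ 4 *
        (J C η w c (m2 + (d20 * e ^ 2 + d40 * e ^ 4)) μ2 e p * (massForm w p.2 * massForm w p.2))) := i2.add i3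
    have e1 : (∫ p : JCfg P j N, J C η w c (m2 + (d20 * e ^ 2 + d40 * e ^ 4)) μ2 e p *
        (U p.2 + 1 / 2 * (d21 * e ^ 2) * massForm w p.2) ^ 2) =
        ∫ p : JCfg P j N, (J C η w c (m2 + (d20 * e ^ 2 + d40 * e ^ 4)) μ2 e p * (U p.2 * U p.2)
          + (d21 * e ^ 2 * (J C η w c (m2 + (d20 * e ^ 2 + d40 * e ^ 4)) μ2 e p * (U p.2 * massForm w p.2))
            + 1 / 4 * d21 ^ 2 * e ^ 4 *
              (J C η w c (m2 + (d20 * e ^ 2 + d40 * e ^ 4)) μ2 e p * (massForm w p.2 * massForm w p.2)))) :=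
      integral_congr_ae (Filter.Eventually.of_forall fun p => by dsimp only; ring)
    rw [e1, integral_add iUU i23, integral_add i2 i3, integral_const_mul, integral_const_mul]
    ring
  have hlin : (∫ p : JCfg P j N, J C η w c (m2 + (d20 * e ^ 2 + d40 * e ^ 4)) μ2 e p *
      (U p.2 + 1 / 2 * (d21 * e ^ 2) * massForm w p.2)) =
      (∫ p : JCfg P j N, J C η w c (m2 + (d20 * e ^ 2 + d40 * e ^ 4)) μ2 e p * U p.2)
        + 1 / 2 * d21 * e ^ 2 * ∫ p : JCfg P j N, J C η w c (m2 + (d20 * e ^ 2 + d40 * e ^ 4)) μ2 e p * massForm w p.2 := by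
    rw [← integral_const_mul, ← integral_add iU (iQ.const_mul _)]
    exact integral_congr_ae (Filter.Eventually.of_forall fun p => by dsimp only; ring)
  rw [hsq, hlin]
  simp only [mul_one]
  have hZ : (∫ p : JCfg P j N, J C η w c (m2 + (d20 * e ^ 2 + d40 * e ^ 4)) μ2 e p) ≠ 0 :=
    (integral_J_pos C η w c (m2 + (d20 * e ^ 2 + d40 * e ^ 4)) μ2 hw hM hμ e).ne'
  field_simp


/-! ## §8 THE OUTER DERIVATIVE: `iteratedDeriv 2` IN THE CHARGE AT `0` of the inner derivative
`g(e) = q_{U²} + δm²_{(2,1)}e²q_{UQ} + ¼δm²_{(2,1)}²e⁴q_{Q²} − (δm²_{(0,2)} + δm²_{(2,2)}e²)q_Q − (q_U + ½δm²_{(2,1)}e²q_Q)²` — §2's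
quotient curves are differentiable on a ball with derivatives differentiable at `0` and `q_U′(0) = 0` (no order-`e` term), so
`g″(0) = q_{U²}″(0) + 2δm²_{(2,1)}q_{UQ}(0) − δm²_{(0,2)}q_Q″(0) − 2δm²_{(2,2)}q_Q(0) − 2q_U(0)q_U″(0) − 2δm²_{(2,1)}q_U(0)q_Q(0)` -/

omit C η w c m2 μ2 in
/-- calculus: for curves `A, B, C, D, E` differentiable on a ball around `0` with derivatives differentiable at `0`,
`iteratedDeriv 2 (e ↦ A + k₁e²B + k₂e⁴C − (k₃ + k₄e²)E − (D + k₅e²E)²) 0 = A″(0) + 2k₁B(0) − k₃E″(0) − 2k₄E(0) − [2D′(0)² +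
2D(0)D″(0) + 4k₅D(0)E(0)]`, and `iteratedDeriv 2 X 0 = X″(0)` for `X = A, D, E`. [folklore] -/
private theorem iteratedDeriv_two_combo {A B Cq D E A' B' Cq' D' E' : ℝ → ℝ}
    {A2 B2 Cq2 D2 E2 k1 k2 k3 k4 k5 r : ℝ} (hr : 0 < r)
    (hA : ∀ e, |e| < r → HasDerivAt A (A' e) e) (hB : ∀ e, |e| < r → HasDerivAt B (B' e) e)
    (hC : ∀ e, |e| < r → HasDerivAt Cq (Cq' e) e) (hD : ∀ e, |e| < r → HasDerivAt D (D' e) e)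
    (hE : ∀ e, |e| < r → HasDerivAt E (E' e) e)
    (hA' : HasDerivAt A' A2 0) (hB' : HasDerivAt B' B2 0) (hC' : HasDerivAt Cq' Cq2 0) (hD' : HasDerivAt D' D2 0)
    (hE' : HasDerivAt E' E2 0) :
    iteratedDeriv 2 (fun e => A e + k1 * e ^ 2 * B e + k2 * e ^ 4 * Cq e - (k3 + k4 * e ^ 2) * E e
        - (D e + k5 * e ^ 2 * E e) ^ 2) 0
      = A2 + 2 * k1 * B 0 - k3 * E2 - 2 * k4 * E 0 - (2 * D' 0 ^ 2 + 2 * D 0 * D2 + 4 * k5 * D 0 * E 0)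
    ∧ iteratedDeriv 2 A 0 = A2 ∧ iteratedDeriv 2 D 0 = D2 ∧ iteratedDeriv 2 E 0 = E2 := by
  have h00 : |(0 : ℝ)| < r := by rwa [abs_zero]
  -- the first derivative on the ball
  have hev : deriv (fun e => A e + k1 * e ^ 2 * B e + k2 * e ^ 4 * Cq e - (k3 + k4 * e ^ 2) * E e
      - (D e + k5 * e ^ 2 * E e) ^ 2) =ᶠ[𝓝 0]
      fun x => A' x + k1 * (2 * x * B x + x ^ 2 * B' x) + k2 * (4 * x ^ 3 * Cq x + x ^ 4 * Cq' x)
        - (2 * k4 * x * E x + (k3 + k4 * x ^ 2) * E' x)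
        - 2 * (D x + k5 * x ^ 2 * E x) * (D' x + k5 * (2 * x * E x + x ^ 2 * E' x)) :=
    Filter.eventually_of_mem (ball_mem_nhds' h00) fun e he => by
      have he' := abs_lt_of_mem_ball' he
      have t2 := ((hasDerivAt_pow 2 e).const_mul k1).fun_mul (hB e he')
      have t3 := ((hasDerivAt_pow 4 e).const_mul k2).fun_mul (hC e he')
      have t4 := (((hasDerivAt_pow 2 e).const_mul k4).const_add k3).fun_mul (hE e he')
      have t5 := ((hD e he').fun_add (((hasDerivAt_pow 2 e).const_mul k5).fun_mul (hE e he'))).fun_pow 2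
      have h12 := (hA e he').fun_add t2
      have h123 := h12.fun_add t3
      have h1234 := h123.fun_sub t4
      have h := h1234.fun_sub t5
      refine (h.congr_deriv ?_).deriv
      simp only [Nat.cast_ofNat]
      ring
  have hevA : deriv A =ᶠ[𝓝 0] A' :=
    Filter.eventually_of_mem (ball_mem_nhds' h00) fun e he => (hA e (abs_lt_of_mem_ball' he)).deriv
  have hevD : deriv D =ᶠ[𝓝 0] D' :=
    Filter.eventually_of_mem (ball_mem_nhds' h00) fun e he => (hD e (abs_lt_of_mem_ball' he)).deriv
  have hevE : deriv E =ᶠ[𝓝 0] E' :=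
    Filter.eventually_of_mem (ball_mem_nhds' h00) fun e he => (hE e (abs_lt_of_mem_ball' he)).deriv
  -- the pieces of the second derivative at `0`
  have hB1 : HasDerivAt (fun e : ℝ => 2 * e * B e) (2 * B 0) 0 := by
    have h := (((hasDerivAt_id (0 : ℝ)).const_mul 2).fun_mul (hB 0 h00))
    refine h.congr_deriv ?_
    simp only [id, mul_zero, zero_mul, add_zero, mul_one]
  have hB2 : HasDerivAt (fun e : ℝ => e ^ 2 * B' e) 0 0 := by
    have h := (hasDerivAt_pow 2 (0 : ℝ)).fun_mul hB'
    refine h.congr_deriv ?_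
    simp
  have hC1 : HasDerivAt (fun e : ℝ => 4 * e ^ 3 * Cq e) 0 0 := by
    have h := ((hasDerivAt_pow 3 (0 : ℝ)).const_mul 4).fun_mul (hC 0 h00)
    refine h.congr_deriv ?_
    simp
  have hC2 : HasDerivAt (fun e : ℝ => e ^ 4 * Cq' e) 0 0 := by
    have h := (hasDerivAt_pow 4 (0 : ℝ)).fun_mul hC'
    refine h.congr_deriv ?_
    simp
  have hE1 : HasDerivAt (fun e : ℝ => 2 * k4 * e * E e) (2 * k4 * E 0) 0 := by
    have h := (((hasDerivAt_id (0 : ℝ)).const_mul (2 * k4)).fun_mul (hE 0 h00))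
    refine h.congr_deriv ?_
    simp only [id, mul_zero, zero_mul, add_zero, mul_one]
  have hE2 : HasDerivAt (fun e : ℝ => (k3 + k4 * e ^ 2) * E' e) (k3 * E2) 0 := by
    have h := (((hasDerivAt_pow 2 (0 : ℝ)).const_mul k4).const_add k3).fun_mul hE'
    refine h.congr_deriv ?_
    simp
  have hEe1 : HasDerivAt (fun e : ℝ => 2 * e * E e) (2 * E 0) 0 := by
    have h := (((hasDerivAt_id (0 : ℝ)).const_mul 2).fun_mul (hE 0 h00))
    refine h.congr_deriv ?_
    simp only [id, mul_zero, zero_mul, add_zero, mul_one]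
  have hEe2 : HasDerivAt (fun e : ℝ => e ^ 2 * E' e) 0 0 := by
    have h := (hasDerivAt_pow 2 (0 : ℝ)).fun_mul hE'
    refine h.congr_deriv ?_
    simp
  have hS : HasDerivAt (fun e : ℝ => D e + k5 * e ^ 2 * E e) (D' 0) 0 := by
    have h := (hD 0 h00).fun_add (((hasDerivAt_pow 2 (0 : ℝ)).const_mul k5).fun_mul (hE 0 h00))
    refine h.congr_deriv ?_
    simp
  have hS' : HasDerivAt (fun e : ℝ => D' e + k5 * (2 * e * E e + e ^ 2 * E' e)) (D2 + k5 * (2 * E 0 + 0)) 0 :=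
    hD'.fun_add ((hEe1.fun_add hEe2).const_mul k5)
  have hSS := (hS.const_mul 2).fun_mul hS'
  have hk1 := (hB1.fun_add hB2).const_mul k1
  have hk2 := (hC1.fun_add hC2).const_mul k2
  have hk34 := hE1.fun_add hE2
  have g1 := hA'.fun_add hk1
  have g2 := g1.fun_add hk2
  have g3 := g2.fun_sub hk34
  have h3 := g3.fun_sub hSS
  refine ⟨?_, ?_, ?_, ?_⟩
  · rw [iteratedDeriv_succ, iteratedDeriv_one, hev.deriv_eq, h3.deriv]
    simp only [mul_zero, zero_mul, add_zero, zero_pow, ne_eq, OfNat.ofNat_ne_zero, not_false_eq_true]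
    ring
  · rw [iteratedDeriv_succ, iteratedDeriv_one, hevA.deriv_eq, hA'.deriv]
  · rw [iteratedDeriv_succ, iteratedDeriv_one, hevD.deriv_eq, hD'.deriv]
  · rw [iteratedDeriv_succ, iteratedDeriv_one, hevE.deriv_eq, hE'.deriv]


/-- **`iteratedDeriv 2` OF THE BODY-OF-RECORD INNER DERIVATIVE AT `e = 0`, RAW FORM** (§7's eventual equality, §2's quotient curves
`q_F = N_F/Z` with `F ∈ {U², UQ, Q², U, Q}`, `F₀ = 1`, and the calculus lemma; the order-`e` term `q_U′(0)` vanishes by `A ↦ −A`):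
`∂²_e[(∂/∂λ)⁺²log Z^{ct}(e,·)∣_{0⁺}]∣_{e=0} = q_{U²}″(0) + 2δm²_{(2,1)}q_{UQ}(0) − δm²_{(0,2)}q_Q″(0) − 2δm²_{(2,2)}q_Q(0) − 2q_U(0)q_U″(0) −
2δm²_{(2,1)}q_U(0)q_Q(0)`. [cite: Balaban1983Higgs3, (1.20) p.416, (1.24) p.417] -/
theorem iteratedDeriv_two_index22_raw (hw : 0 < w) (hm : 0 < m2) (hμ : 0 < μ2) (d20 d01 d21 d02 d22 d40 : ℝ)
    {U : Cfg P j N → ℝ} (hU : ∀ φ, U φ = (∑ y : Site P j, w * ‖φ y‖ ^ 4) + 1 / 2 * d01 * massForm w φ) :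
    iteratedDeriv 2 (fun e : ℝ => iteratedDerivWithin 2 (fun lam : ℝ => Real.log (∫ p : JCfg P j N,
        J C η w c (m2 + (d20 * e ^ 2 + d01 * lam + d21 * (e ^ 2 * lam) + d02 * lam ^ 2
          + d22 * (e ^ 2 * lam ^ 2) + d40 * e ^ 4)) μ2 e p *
          Real.exp (-(lam * ∑ y : Site P j, w * ‖p.2 y‖ ^ 4)))) (Set.Ici 0) 0) 0 =
      iteratedDeriv 2 (fun e : ℝ => (∫ p : JCfg P j N, J C η w c (m2 + (d20 * e ^ 2 + d40 * e ^ 4)) μ2 e p *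
            (U p.2 * U p.2)) / ∫ p : JCfg P j N, J C η w c (m2 + (d20 * e ^ 2 + d40 * e ^ 4)) μ2 e p * (1 : ℝ)) 0
        + 2 * d21 * ((∫ p : JCfg P j N, J C η w c m2 μ2 0 p * (U p.2 * massForm w p.2)) /
            ∫ p : JCfg P j N, J C η w c m2 μ2 0 p * (1 : ℝ))
        - d02 * iteratedDeriv 2 (fun e : ℝ => (∫ p : JCfg P j N, J C η w c (m2 + (d20 * e ^ 2 + d40 * e ^ 4)) μ2 e p *
            massForm w p.2) / ∫ p : JCfg P j N, J C η w c (m2 + (d20 * e ^ 2 + d40 * e ^ 4)) μ2 e p * (1 : ℝ)) 0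
        - 2 * d22 * ((∫ p : JCfg P j N, J C η w c m2 μ2 0 p * massForm w p.2) /
            ∫ p : JCfg P j N, J C η w c m2 μ2 0 p * (1 : ℝ))
        - 2 * ((∫ p : JCfg P j N, J C η w c m2 μ2 0 p * U p.2) / ∫ p : JCfg P j N, J C η w c m2 μ2 0 p * (1 : ℝ)) *
            iteratedDeriv 2 (fun e : ℝ => (∫ p : JCfg P j N, J C η w c (m2 + (d20 * e ^ 2 + d40 * e ^ 4)) μ2 e p * U p.2) /
              ∫ p : JCfg P j N, J C η w c (m2 + (d20 * e ^ 2 + d40 * e ^ 4)) μ2 e p * (1 : ℝ)) 0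
        - 2 * d21 * ((∫ p : JCfg P j N, J C η w c m2 μ2 0 p * U p.2) / ∫ p : JCfg P j N, J C η w c m2 μ2 0 p * (1 : ℝ)) *
            ((∫ p : JCfg P j N, J C η w c m2 μ2 0 p * massForm w p.2) / ∫ p : JCfg P j N, J C η w c m2 μ2 0 p * (1 : ℝ)) := by
  rw [(iteratedDerivWithin_two_logZct_eventuallyEq C η w c m2 μ2 hw hm hμ d20 d01 d21 d02 d22 d40 hU).iteratedDeriv_eq 2]
  obtain ⟨r, B, hr, hc, hc', hc''⟩ := exists_ball_c20 m2 hm d20 d40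
  have hd : ∀ e, |e| < r → HasDerivAt (fun s : ℝ => d20 * s ^ 2 + d40 * s ^ 4) (2 * d20 * e + 4 * d40 * e ^ 3) e :=
    fun e _ => hasDerivAt_c20 d20 d40 e
  have hd' : ∀ e, |e| < r → HasDerivAt (fun s : ℝ => 2 * d20 * s + 4 * d40 * s ^ 3) (2 * d20 + 12 * d40 * e ^ 2) e :=
    fun e _ => hasDerivAt_c20' d20 d40 e
  have h0 : (fun s : ℝ => d20 * s ^ 2 + d40 * s ^ 4) 0 = 0 := by simp
  have h0' : (fun s : ℝ => 2 * d20 * s + 4 * d40 * s ^ 3) 0 = 0 := by simp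
  have h00 : |(0 : ℝ)| < r := by rwa [abs_zero]
  have hUg := expGrowth_U w d01 hU
  have hmF := B3Eq123RenormalizationConditions.expGrowth_massForm (P := P) (j := j) (N := N) w
  have h1g : ExpGrowth (fun _ : Cfg P j N => (1 : ℝ)) := ExpGrowth.const 1
  have h1p : ∀ φ : Cfg P j N, (0 : ℝ) < (fun _ : Cfg P j N => (1 : ℝ)) φ := fun _ => one_pos
  -- the five quotient curves
  have hA := fun e (he : |e| < r) =>
    hasDerivAt_quot_curve_of_ball C η w c m2 μ2 hw hm hμ (hUg.mul hUg) h1g h1p hd hc hc' he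
  have hB := fun e (he : |e| < r) =>
    hasDerivAt_quot_curve_of_ball C η w c m2 μ2 hw hm hμ (hUg.mul hmF) h1g h1p hd hc hc' he
  have hC := fun e (he : |e| < r) =>
    hasDerivAt_quot_curve_of_ball C η w c m2 μ2 hw hm hμ (hmF.mul hmF) h1g h1p hd hc hc' he
  have hD := fun e (he : |e| < r) =>
    hasDerivAt_quot_curve_of_ball C η w c m2 μ2 hw hm hμ hUg h1g h1p hd hc hc' he
  have hE := fun e (he : |e| < r) =>
    hasDerivAt_quot_curve_of_ball C η w c m2 μ2 hw hm hμ hmF h1g h1p hd hc hc' he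
  have hA' := hasDerivAt_deriv_quot_curve_zero_of_ball C η w c m2 μ2 hw hm hμ (hUg.mul hUg) h1g h1p hr hd hd' hc hc' hc''
    h0 h0'
  have hB' := hasDerivAt_deriv_quot_curve_zero_of_ball C η w c m2 μ2 hw hm hμ (hUg.mul hmF) h1g h1p hr hd hd' hc hc' hc''
    h0 h0'
  have hC' := hasDerivAt_deriv_quot_curve_zero_of_ball C η w c m2 μ2 hw hm hμ (hmF.mul hmF) h1g h1p hr hd hd' hc hc' hc''
    h0 h0'
  have hD' := hasDerivAt_deriv_quot_curve_zero_of_ball C η w c m2 μ2 hw hm hμ hUg h1g h1p hr hd hd' hc hc' hc'' h0 h0'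
  have hE' := hasDerivAt_deriv_quot_curve_zero_of_ball C η w c m2 μ2 hw hm hμ hmF h1g h1p hr hd hd' hc hc' hc'' h0 h0'
  have hmain := iteratedDeriv_two_combo (k1 := d21) (k2 := 1 / 4 * d21 ^ 2) (k3 := d02) (k4 := d22) (k5 := 1 / 2 * d21)
    hr hA hB hC hD hE hA' hB' hC' hD' hE'
  -- the order-`e` derivative of `q_U` at `0` vanishes (`N′(0) = Z′(0) = 0`)
  have hN0 := B3Eq123RenormalizationConditions.integral_D1_J_massCurve_zero C η w c m2 μ2 hw hm hμ hUg (ct := fun s : ℝ => d20 * s ^ 2 + d40 * s ^ 4)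
    (ct' := fun s : ℝ => 2 * d20 * s + 4 * d40 * s ^ 3) h0 h0'
  have hZ0 := B3Eq123RenormalizationConditions.integral_D1_J_massCurve_zero C η w c m2 μ2 hw hm hμ h1g (ct := fun s : ℝ => d20 * s ^ 2 + d40 * s ^ 4)
    (ct' := fun s : ℝ => 2 * d20 * s + 4 * d40 * s ^ 3) h0 h0'
  have hfun : (fun e : ℝ =>
        (∫ p : JCfg P j N, J C η w c (m2 + (d20 * e ^ 2 + d40 * e ^ 4)) μ2 e p * (U p.2 * U p.2)) /
            (∫ p : JCfg P j N, J C η w c (m2 + (d20 * e ^ 2 + d40 * e ^ 4)) μ2 e p * (1 : ℝ))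
          + d21 * e ^ 2 * ((∫ p : JCfg P j N, J C η w c (m2 + (d20 * e ^ 2 + d40 * e ^ 4)) μ2 e p *
              (U p.2 * massForm w p.2)) / (∫ p : JCfg P j N, J C η w c (m2 + (d20 * e ^ 2 + d40 * e ^ 4)) μ2 e p * (1 : ℝ)))
          + 1 / 4 * d21 ^ 2 * e ^ 4 * ((∫ p : JCfg P j N, J C η w c (m2 + (d20 * e ^ 2 + d40 * e ^ 4)) μ2 e p *
              (massForm w p.2 * massForm w p.2)) /
                (∫ p : JCfg P j N, J C η w c (m2 + (d20 * e ^ 2 + d40 * e ^ 4)) μ2 e p * (1 : ℝ)))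
          - (d02 + d22 * e ^ 2) * ((∫ p : JCfg P j N, J C η w c (m2 + (d20 * e ^ 2 + d40 * e ^ 4)) μ2 e p * massForm w p.2) /
              (∫ p : JCfg P j N, J C η w c (m2 + (d20 * e ^ 2 + d40 * e ^ 4)) μ2 e p * (1 : ℝ)))
          - ((∫ p : JCfg P j N, J C η w c (m2 + (d20 * e ^ 2 + d40 * e ^ 4)) μ2 e p * U p.2) /
              (∫ p : JCfg P j N, J C η w c (m2 + (d20 * e ^ 2 + d40 * e ^ 4)) μ2 e p * (1 : ℝ))
            + 1 / 2 * d21 * e ^ 2 * ((∫ p : JCfg P j N, J C η w c (m2 + (d20 * e ^ 2 + d40 * e ^ 4)) μ2 e p *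
                massForm w p.2) / (∫ p : JCfg P j N, J C η w c (m2 + (d20 * e ^ 2 + d40 * e ^ 4)) μ2 e p * (1 : ℝ)))) ^ 2) =
      fun e : ℝ =>
        (∫ p : JCfg P j N, J C η w c (m2 + (fun s : ℝ => d20 * s ^ 2 + d40 * s ^ 4) e) μ2 e p *
            (fun φ : Cfg P j N => U φ * U φ) p.2) /
            (∫ p : JCfg P j N, J C η w c (m2 + (fun s : ℝ => d20 * s ^ 2 + d40 * s ^ 4) e) μ2 e p *
              (fun _ : Cfg P j N => (1 : ℝ)) p.2)
          + d21 * e ^ 2 * ((∫ p : JCfg P j N, J C η w c (m2 + (fun s : ℝ => d20 * s ^ 2 + d40 * s ^ 4) e) μ2 e p *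
              (fun φ : Cfg P j N => U φ * massForm w φ) p.2) /
              (∫ p : JCfg P j N, J C η w c (m2 + (fun s : ℝ => d20 * s ^ 2 + d40 * s ^ 4) e) μ2 e p *
                (fun _ : Cfg P j N => (1 : ℝ)) p.2))
          + 1 / 4 * d21 ^ 2 * e ^ 4 * ((∫ p : JCfg P j N, J C η w c (m2 + (fun s : ℝ => d20 * s ^ 2 + d40 * s ^ 4) e) μ2 e p *
              (fun φ : Cfg P j N => massForm w φ * massForm w φ) p.2) /
              (∫ p : JCfg P j N, J C η w c (m2 + (fun s : ℝ => d20 * s ^ 2 + d40 * s ^ 4) e) μ2 e p *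
                (fun _ : Cfg P j N => (1 : ℝ)) p.2))
          - (d02 + d22 * e ^ 2) * ((∫ p : JCfg P j N, J C η w c (m2 + (fun s : ℝ => d20 * s ^ 2 + d40 * s ^ 4) e) μ2 e p *
              massForm w p.2) /
              (∫ p : JCfg P j N, J C η w c (m2 + (fun s : ℝ => d20 * s ^ 2 + d40 * s ^ 4) e) μ2 e p *
                (fun _ : Cfg P j N => (1 : ℝ)) p.2))
          - ((∫ p : JCfg P j N, J C η w c (m2 + (fun s : ℝ => d20 * s ^ 2 + d40 * s ^ 4) e) μ2 e p * U p.2) /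
              (∫ p : JCfg P j N, J C η w c (m2 + (fun s : ℝ => d20 * s ^ 2 + d40 * s ^ 4) e) μ2 e p *
                (fun _ : Cfg P j N => (1 : ℝ)) p.2)
            + 1 / 2 * d21 * e ^ 2 * ((∫ p : JCfg P j N, J C η w c (m2 + (fun s : ℝ => d20 * s ^ 2 + d40 * s ^ 4) e) μ2 e p *
                massForm w p.2) /
                (∫ p : JCfg P j N, J C η w c (m2 + (fun s : ℝ => d20 * s ^ 2 + d40 * s ^ 4) e) μ2 e p *
                  (fun _ : Cfg P j N => (1 : ℝ)) p.2))) ^ 2 := by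
    funext e; rfl
  have hfA : (fun e : ℝ => (∫ p : JCfg P j N, J C η w c (m2 + (d20 * e ^ 2 + d40 * e ^ 4)) μ2 e p *
            (U p.2 * U p.2)) / ∫ p : JCfg P j N, J C η w c (m2 + (d20 * e ^ 2 + d40 * e ^ 4)) μ2 e p * (1 : ℝ)) =
      fun e : ℝ => (∫ p : JCfg P j N, J C η w c (m2 + (fun s : ℝ => d20 * s ^ 2 + d40 * s ^ 4) e) μ2 e p *
            (fun φ : Cfg P j N => U φ * U φ) p.2) /
            (∫ p : JCfg P j N, J C η w c (m2 + (fun s : ℝ => d20 * s ^ 2 + d40 * s ^ 4) e) μ2 e p *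
              (fun _ : Cfg P j N => (1 : ℝ)) p.2) := by
    funext e; rfl
  have hfD : (fun e : ℝ => (∫ p : JCfg P j N, J C η w c (m2 + (d20 * e ^ 2 + d40 * e ^ 4)) μ2 e p * U p.2) /
              ∫ p : JCfg P j N, J C η w c (m2 + (d20 * e ^ 2 + d40 * e ^ 4)) μ2 e p * (1 : ℝ)) =
      fun e : ℝ => (∫ p : JCfg P j N, J C η w c (m2 + (fun s : ℝ => d20 * s ^ 2 + d40 * s ^ 4) e) μ2 e p * U p.2) /
            (∫ p : JCfg P j N, J C η w c (m2 + (fun s : ℝ => d20 * s ^ 2 + d40 * s ^ 4) e) μ2 e p *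
              (fun _ : Cfg P j N => (1 : ℝ)) p.2) := by
    funext e; rfl
  have hfE : (fun e : ℝ => (∫ p : JCfg P j N, J C η w c (m2 + (d20 * e ^ 2 + d40 * e ^ 4)) μ2 e p *
            massForm w p.2) / ∫ p : JCfg P j N, J C η w c (m2 + (d20 * e ^ 2 + d40 * e ^ 4)) μ2 e p * (1 : ℝ)) =
      fun e : ℝ => (∫ p : JCfg P j N, J C η w c (m2 + (fun s : ℝ => d20 * s ^ 2 + d40 * s ^ 4) e) μ2 e p *
            massForm w p.2) /
            (∫ p : JCfg P j N, J C η w c (m2 + (fun s : ℝ => d20 * s ^ 2 + d40 * s ^ 4) e) μ2 e p *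
              (fun _ : Cfg P j N => (1 : ℝ)) p.2) := by
    funext e; rfl
  rw [hfun, hmain.1, hfA, hmain.2.1, hfD, hmain.2.2.1, hfE, hmain.2.2.2, hN0, hZ0]
  have hz : m2 + (d20 * (0 : ℝ) ^ 2 + d40 * (0 : ℝ) ^ 4) = m2 := by ring
  rw [hz]
  ring


/-! ## §9 THE VALUE AT `e = 0` AS FREE-FIELD MOMENTS (the `A`-integrals done: BRICK 7 `J_zero`, `integral_D2_J_zero`; §3):
every `q_F″(0)` is the covariance `Cov₀(Y, F)` of `F` with the `A`-averaged order-`e²` insertion minus its counterterm,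
`Y = X − δm²_{(2,0)}Q`, and every `q_F(0)` is the free expectation `⟨F⟩₀` (`Z_A` cancels) -/

/-- **THE INDEX `(2,2)` OF (1.24), DERIVED FROM THE MEASURE — cumulant form, any counterterm letters.**  For
`Z^{ct}(e,λ) = ∫dA dφ e^{−S^ε_{e,m²+δm²(e,λ)}}e^{−λΣ_yη^d∣φ(y)∣⁴}` with print's full weight-`≤ 4` series inserted, the body-of-record
derivative of `E1of124R` at `(α,β) = (2,2)` is
**`∂²_e[(∂/∂λ)⁺²log Z^{ct}(e,·)∣_{0⁺}]∣_{e=0} = Cov₀(Y,U²) − 2⟨U⟩₀Cov₀(Y,U) + 2δm²_{(2,1)}Cov₀(U,Q) − δm²_{(0,2)}Cov₀(Y,Q) −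
2δm²_{(2,2)}⟨Q⟩₀`**, `Y = X − δm²_{(2,0)}Q`, `U = Σ_yη^d∣φ(y)∣⁴ + ½δm²_{(0,1)}Q`, `Q = Σ_xη^d∣φ(x)∣²`, free-field moments
`⟨F⟩₀ = ∫W₀F/∫W₀`, the covariances written over the common denominator `(∫W₀)²`.  Print's coefficient of `e²λ²` in `E₁` is
`(2!·2!)⁻¹` times this number. [cite: Balaban1983Higgs3, (1.20)–(1.22) p.416, (1.23)–(1.24) p.417] [cite: GlimmJaffeQP1987, §8.4–8.5] -/
theorem iteratedDeriv_two_index22_eq_moments (hw : 0 < w) (hm : 0 < m2) (hμ : 0 < μ2) (d20 d01 d21 d02 d22 d40 : ℝ)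
    {X U : Cfg P j N → ℝ}
    (hX : ∀ φ, X φ = (∑ b : PBond P j, w * (c ^ 2 * η ^ 2) * G w c μ2 b.src b.src * ⟪φ b.src, C.q (C.q (φ b.tgt))⟫_ℝ)
      + ∑ b : PBond P j, ∑ b' : PBond P j, (w * (c ^ 2 * η)) * (w * (c ^ 2 * η)) *
          (G w c μ2 b.src b'.src * if b.dir = b'.dir then 1 else 0) *
            (⟪φ b.src, C.q (φ b.tgt)⟫_ℝ * ⟪φ b'.src, C.q (φ b'.tgt)⟫_ℝ))
    (hU : ∀ φ, U φ = (∑ y : Site P j, w * ‖φ y‖ ^ 4) + 1 / 2 * d01 * massForm w φ) :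
    iteratedDeriv 2 (fun e : ℝ => iteratedDerivWithin 2 (fun lam : ℝ => Real.log (∫ p : JCfg P j N,
        J C η w c (m2 + (d20 * e ^ 2 + d01 * lam + d21 * (e ^ 2 * lam) + d02 * lam ^ 2
          + d22 * (e ^ 2 * lam ^ 2) + d40 * e ^ 4)) μ2 e p *
          Real.exp (-(lam * ∑ y : Site P j, w * ‖p.2 y‖ ^ 4)))) (Set.Ici 0) 0) 0 =
      ((∫ φ : Cfg P j N, weight C η w c m2 (0 : VecField P j ℝ) φ * ((X φ - d20 * massForm w φ) * (U φ * U φ))) *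
            (∫ φ : Cfg P j N, weight C η w c m2 (0 : VecField P j ℝ) φ)
          - (∫ φ : Cfg P j N, weight C η w c m2 (0 : VecField P j ℝ) φ * (U φ * U φ)) *
            (∫ φ : Cfg P j N, weight C η w c m2 (0 : VecField P j ℝ) φ * (X φ - d20 * massForm w φ))) /
          (∫ φ : Cfg P j N, weight C η w c m2 (0 : VecField P j ℝ) φ) ^ 2
        - 2 * ((∫ φ : Cfg P j N, weight C η w c m2 (0 : VecField P j ℝ) φ * U φ) /
            ∫ φ : Cfg P j N, weight C η w c m2 (0 : VecField P j ℝ) φ) *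
          (((∫ φ : Cfg P j N, weight C η w c m2 (0 : VecField P j ℝ) φ * ((X φ - d20 * massForm w φ) * U φ)) *
              (∫ φ : Cfg P j N, weight C η w c m2 (0 : VecField P j ℝ) φ)
            - (∫ φ : Cfg P j N, weight C η w c m2 (0 : VecField P j ℝ) φ * U φ) *
              (∫ φ : Cfg P j N, weight C η w c m2 (0 : VecField P j ℝ) φ * (X φ - d20 * massForm w φ))) /
            (∫ φ : Cfg P j N, weight C η w c m2 (0 : VecField P j ℝ) φ) ^ 2)
        + 2 * d21 * (((∫ φ : Cfg P j N, weight C η w c m2 (0 : VecField P j ℝ) φ * (U φ * massForm w φ)) *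
              (∫ φ : Cfg P j N, weight C η w c m2 (0 : VecField P j ℝ) φ)
            - (∫ φ : Cfg P j N, weight C η w c m2 (0 : VecField P j ℝ) φ * U φ) *
              (∫ φ : Cfg P j N, weight C η w c m2 (0 : VecField P j ℝ) φ * massForm w φ)) /
            (∫ φ : Cfg P j N, weight C η w c m2 (0 : VecField P j ℝ) φ) ^ 2)
        - d02 * (((∫ φ : Cfg P j N, weight C η w c m2 (0 : VecField P j ℝ) φ * ((X φ - d20 * massForm w φ) * massForm w φ)) *
              (∫ φ : Cfg P j N, weight C η w c m2 (0 : VecField P j ℝ) φ)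
            - (∫ φ : Cfg P j N, weight C η w c m2 (0 : VecField P j ℝ) φ * massForm w φ) *
              (∫ φ : Cfg P j N, weight C η w c m2 (0 : VecField P j ℝ) φ * (X φ - d20 * massForm w φ))) /
            (∫ φ : Cfg P j N, weight C η w c m2 (0 : VecField P j ℝ) φ) ^ 2)
        - 2 * d22 * ((∫ φ : Cfg P j N, weight C η w c m2 (0 : VecField P j ℝ) φ * massForm w φ) /
            ∫ φ : Cfg P j N, weight C η w c m2 (0 : VecField P j ℝ) φ) := by
  rw [iteratedDeriv_two_index22_raw C η w c m2 μ2 hw hm hμ d20 d01 d21 d02 d22 d40 hU]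
  -- the curve `c(e) = δm²_{(2,0)}e² + δm²_{(4,0)}e⁴`
  set ct : ℝ → ℝ := fun e => d20 * e ^ 2 + d40 * e ^ 4 with hct
  set ct' : ℝ → ℝ := fun e => 2 * d20 * e + 4 * d40 * e ^ 3 with hct'
  set ct'' : ℝ → ℝ := fun e => 2 * d20 + 12 * d40 * e ^ 2 with hct''
  have hd : ∀ e, HasDerivAt ct (ct' e) e := fun e => by
    have h := ((hasDerivAt_pow 2 e).const_mul d20).add ((hasDerivAt_pow 4 e).const_mul d40)
    refine h.congr_deriv ?_
    simp only [hct', Nat.cast_ofNat]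
    ring
  have hd' : ∀ e, HasDerivAt ct' (ct'' e) e := fun e => by
    have h := (((hasDerivAt_id e).const_mul (2 * d20))).add ((hasDerivAt_pow 3 e).const_mul (4 * d40))
    refine h.congr_deriv ?_
    simp only [hct'', Nat.cast_ofNat]
    ring
  have hc'' : ContinuousAt ct'' 0 := (continuous_const.add (continuous_const.mul (continuous_pow 2))).continuousAt
  have h0 : ct 0 = 0 := by simp only [hct]; ring
  have h0' : ct' 0 = 0 := by simp only [hct']; ring
  have hκ : 1 / 2 * ct'' 0 = d20 := by simp only [hct'']; ring
  have hUg := expGrowth_U w d01 hU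
  have hmF := B3Eq123RenormalizationConditions.expGrowth_massForm (P := P) (j := j) (N := N) w
  have hXg := expGrowth_X C η w c μ2 hX
  have h1g : ExpGrowth (fun _ : Cfg P j N => (1 : ℝ)) := ExpGrowth.const 1
  have h1p : ∀ φ : Cfg P j N, (0 : ℝ) < (fun _ : Cfg P j N => (1 : ℝ)) φ := fun _ => one_pos
  have hmUU := iteratedDeriv_two_quot_curve_eq_moments C η w c m2 μ2 hw hm hμ (hUg.mul hUg) h1g h1p hd hd' hc'' h0 h0' hX
  have hmU := iteratedDeriv_two_quot_curve_eq_moments C η w c m2 μ2 hw hm hμ hUg h1g h1p hd hd' hc'' h0 h0' hX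
  have hmQ := iteratedDeriv_two_quot_curve_eq_moments C η w c m2 μ2 hw hm hμ hmF h1g h1p hd hd' hc'' h0 h0' hX
  have hfA : (fun e : ℝ => (∫ p : JCfg P j N, J C η w c (m2 + (d20 * e ^ 2 + d40 * e ^ 4)) μ2 e p *
            (U p.2 * U p.2)) / ∫ p : JCfg P j N, J C η w c (m2 + (d20 * e ^ 2 + d40 * e ^ 4)) μ2 e p * (1 : ℝ)) =
      fun e : ℝ => (∫ p : JCfg P j N, J C η w c (m2 + ct e) μ2 e p * (fun φ : Cfg P j N => U φ * U φ) p.2) /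
            (∫ p : JCfg P j N, J C η w c (m2 + ct e) μ2 e p * (fun _ : Cfg P j N => (1 : ℝ)) p.2) := by
    funext e; rfl
  have hfD : (fun e : ℝ => (∫ p : JCfg P j N, J C η w c (m2 + (d20 * e ^ 2 + d40 * e ^ 4)) μ2 e p * U p.2) /
              ∫ p : JCfg P j N, J C η w c (m2 + (d20 * e ^ 2 + d40 * e ^ 4)) μ2 e p * (1 : ℝ)) =
      fun e : ℝ => (∫ p : JCfg P j N, J C η w c (m2 + ct e) μ2 e p * U p.2) /
            (∫ p : JCfg P j N, J C η w c (m2 + ct e) μ2 e p * (fun _ : Cfg P j N => (1 : ℝ)) p.2) := by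
    funext e; rfl
  have hfE : (fun e : ℝ => (∫ p : JCfg P j N, J C η w c (m2 + (d20 * e ^ 2 + d40 * e ^ 4)) μ2 e p *
            massForm w p.2) / ∫ p : JCfg P j N, J C η w c (m2 + (d20 * e ^ 2 + d40 * e ^ 4)) μ2 e p * (1 : ℝ)) =
      fun e : ℝ => (∫ p : JCfg P j N, J C η w c (m2 + ct e) μ2 e p * massForm w p.2) /
            (∫ p : JCfg P j N, J C η w c (m2 + ct e) μ2 e p * (fun _ : Cfg P j N => (1 : ℝ)) p.2) := by
    funext e; rfl
  rw [hfA, hmUU, hfD, hmU, hfE, hmQ, hκ]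
  -- the `A`-integrals at `e = 0`
  have hZA : (∫ A : Cfg P j P.d, WA η w c μ2 A) ≠ 0 := (ZA_pos η w c μ2 hw hμ).ne'
  have hM0 : (∫ φ : Cfg P j N, weight C η w c m2 (0 : VecField P j ℝ) φ) ≠ 0 := (B3WT226Traces.Z_pos C η w c m2 hw hm).ne'
  have eUQ : (∫ p : JCfg P j N, J C η w c m2 μ2 0 p * (U p.2 * massForm w p.2)) =
      (∫ A : Cfg P j P.d, WA η w c μ2 A) *
        ∫ φ : Cfg P j N, weight C η w c m2 (0 : VecField P j ℝ) φ * (U φ * massForm w φ) :=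
    integral_J_zero_mul C η w c m2 μ2 (fun φ => U φ * massForm w φ)
  have eQ : (∫ p : JCfg P j N, J C η w c m2 μ2 0 p * massForm w p.2) =
      (∫ A : Cfg P j P.d, WA η w c μ2 A) * ∫ φ : Cfg P j N, weight C η w c m2 (0 : VecField P j ℝ) φ * massForm w φ :=
    integral_J_zero_mul C η w c m2 μ2 (massForm w)
  have eU : (∫ p : JCfg P j N, J C η w c m2 μ2 0 p * U p.2) =
      (∫ A : Cfg P j P.d, WA η w c μ2 A) * ∫ φ : Cfg P j N, weight C η w c m2 (0 : VecField P j ℝ) φ * U φ :=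
    integral_J_zero_mul C η w c m2 μ2 U
  have e1 : (∫ p : JCfg P j N, J C η w c m2 μ2 0 p * (1 : ℝ)) =
      (∫ A : Cfg P j P.d, WA η w c μ2 A) * ∫ φ : Cfg P j N, weight C η w c m2 (0 : VecField P j ℝ) φ := by
    have h := integral_J_zero_mul (P := P) (j := j) C η w c m2 μ2 (fun _ => (1 : ℝ))
    simp only [mul_one] at h
    simpa only [mul_one] using h
  rw [eUQ, eQ, eU, e1]
  simp only [mul_one]
  field_simp
  ring


/-! ## §10 WICK'S THEOREM AT PRINT'S `δm²_{(0,1)} = −4(N+2)C^ε_0(0)`: the interaction is Wick-ordered, `U = V_: − K₀`, `V_: =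
Σ_yη^d:∣φ(y)∣⁴:`, `K₀ = ∣T∣η^dN(N+2)C₀(0)²` (§4 `U_eq_sumWick4_of_print`); `Cov₀(Y, V_:) = 0` (§4 `integral_W_Y`: no connected vacuum
graph joins ONE Wick-ordered quartic vertex to ②, ④ or a mass vertex), `⟨V_:⟩₀ = 0` (BRICK 1 `integral_sumWick4`), `Cov₀(V_:, Q) = 0`
(the mass vertex cannot close a graph with one Wick-ordered quartic vertex) — so the constant `K₀` and the `δm²_{(2,1)}` term drop
out and **the `(2,2)` vacuum term is `κ₃(Y; V_:, V_:) − δm²_{(0,2)}·Cov₀(Y,Q) − 2δm²_{(2,2)}⟨Q⟩₀`**: the third joint cumulant = the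
connected graphs with TWO Wick-ordered quartic vertices and the subtracted order-`e²` insertion (the sunset whose lines carry ②, ④ or
the `−δm²_{(2,0)}` vertex, and the vector line bridging two sunset lines), the `δm²_{(0,2)}` bubble dressed the same way, and the
`δm²_{(2,2)}` bubble -/

omit μ2 in
/-- `∫W₀·V_:·Q = 0` — the mass vertex (1.7) cannot close a vacuum graph with ONE Wick-ordered quartic vertex (§4 `integral_wick4_bil`
at `M = 1`, `u = v`; = BRICK 15 `integral_sumWick4_massForm`). [cite: GlimmJaffeQP1987, Cor. 8.3.2] -/
private theorem integral_W_massForm (hw : 0 < w) (hm : 0 < m2) {W : Cfg P j N → ℝ}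
    (hW : ∀ φ, W φ = ∑ y : Site P j, w * wick4 w c m2 y φ) :
    ∫ φ : Cfg P j N, weight C η w c m2 (0 : VecField P j ℝ) φ * (W φ * massForm w φ) = 0 := by
  have hq : ∀ (φ : Cfg P j N) (z : Site P j),
      ‖φ z‖ ^ 2 = ⟪φ z, (1 : EuclideanSpace ℝ (Fin N) →L[ℝ] EuclideanSpace ℝ (Fin N)) (φ z)⟫_ℝ := fun φ z => by
    rw [one_apply_eq_self, real_inner_self_eq_norm_sq]
  have e1 : (fun φ : Cfg P j N => weight C η w c m2 (0 : VecField P j ℝ) φ * (W φ * massForm w φ)) =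
      fun φ => ∑ y : Site P j, ∑ z : Site P j, (w * w) * (weight C η w c m2 (0 : VecField P j ℝ) φ *
        (wick4 w c m2 y φ * ⟪φ z, (1 : EuclideanSpace ℝ (Fin N) →L[ℝ] EuclideanSpace ℝ (Fin N)) (φ z)⟫_ℝ)) := by
    funext φ
    rw [hW, massForm, Finset.sum_mul_sum, Finset.mul_sum]
    refine Finset.sum_congr rfl fun y _ => ?_
    rw [Finset.mul_sum]
    exact Finset.sum_congr rfl fun z _ => by rw [hq]; ring
  have hi : ∀ y z : Site P j, Integrable (fun φ : Cfg P j N => (w * w) * (weight C η w c m2 (0 : VecField P j ℝ) φ *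
      (wick4 w c m2 y φ * ⟪φ z, (1 : EuclideanSpace ℝ (Fin N) →L[ℝ] EuclideanSpace ℝ (Fin N)) (φ z)⟫_ℝ))) :=
    fun y z => (((expGrowth_wick4 w c m2 y).mul (ExpGrowth.inner_op_apply z z _)).integrable C η w c m2 hw hm).const_mul _
  rw [e1, integral_finsetSum _ (fun y _ => integrable_finsetSum _ fun z _ => hi y z)]
  refine Finset.sum_eq_zero fun y _ => ?_
  rw [integral_finsetSum _ (fun z _ => hi y z)]
  refine Finset.sum_eq_zero fun z _ => ?_
  rw [integral_const_mul, integral_wick4_bil C η w c m2 hw hm y z z, mul_zero]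

/-- **THE INDEX `(2,2)` OF (1.24) AT PRINT'S `δm²_{(0,1)} = −4(N+2)C^ε_0(0)` — CUMULANT FORM:
`∂²_e[(∂/∂λ)⁺²log Z^{ct}(e,·)∣_{0⁺}]∣_{e=0} = κ₃(Y; V_:, V_:) − δm²_{(0,2)}·Cov₀(Y,Q) − 2δm²_{(2,2)}·N·Σ_xη^dC^ε_0(x,x)`**, with
`κ₃(Y; V_:, V_:) = [⟨YV_:²⟩₀∫W₀ − ⟨V_:²⟩₀⟨Y⟩₀]/(∫W₀)²·(∫W₀)²…` written as `(∫W₀YV_:²·∫W₀ − ∫W₀V_:²·∫W₀Y)/(∫W₀)²` (the third joint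
cumulant: `⟨V_:⟩₀ = 0 = Cov₀(Y,V_:)`), `Cov₀(Y,Q) = (∫W₀YQ·∫W₀ − ∫W₀Q·∫W₀Y)/(∫W₀)²`, `Y = X − δm²_{(2,0)}Q`, `V_: = Σ_yη^d:∣φ(y)∣⁴:` —
whatever `δm²_{(2,0)}, δm²_{(2,1)}, δm²_{(0,2)}, δm²_{(2,2)}, δm²_{(4,0)}` are (`δm²_{(2,1)}` and `δm²_{(4,0)}` do not enter).
The explicit propagator sums of `κ₃` and `Cov₀(Y,Q)` (three-loop vacuum kernels) are NOT evaluated here.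
[cite: Balaban1983Higgs3, (1.20)–(1.22) p.416, (1.23)–(1.24) p.417] [cite: GlimmJaffeQP1987, Cor. 8.3.2, (9.1.5)] -/
theorem iteratedDeriv_two_index22_at_print_d01 (hw : 0 < w) (hm : 0 < m2) (hμ : 0 < μ2) (d20 d01 d21 d02 d22 d40 : ℝ)
    (hd01 : d01 = -(4 * (N + 2) * C0 (P := P) (j := j) w c m2)) {X : Cfg P j N → ℝ}
    (hX : ∀ φ, X φ = (∑ b : PBond P j, w * (c ^ 2 * η ^ 2) * G w c μ2 b.src b.src * ⟪φ b.src, C.q (C.q (φ b.tgt))⟫_ℝ)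
      + ∑ b : PBond P j, ∑ b' : PBond P j, (w * (c ^ 2 * η)) * (w * (c ^ 2 * η)) *
          (G w c μ2 b.src b'.src * if b.dir = b'.dir then 1 else 0) *
            (⟪φ b.src, C.q (φ b.tgt)⟫_ℝ * ⟪φ b'.src, C.q (φ b'.tgt)⟫_ℝ)) :
    iteratedDeriv 2 (fun e : ℝ => iteratedDerivWithin 2 (fun lam : ℝ => Real.log (∫ p : JCfg P j N,
        J C η w c (m2 + (d20 * e ^ 2 + d01 * lam + d21 * (e ^ 2 * lam) + d02 * lam ^ 2
          + d22 * (e ^ 2 * lam ^ 2) + d40 * e ^ 4)) μ2 e p *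
          Real.exp (-(lam * ∑ y : Site P j, w * ‖p.2 y‖ ^ 4)))) (Set.Ici 0) 0) 0 =
      ((∫ φ : Cfg P j N, weight C η w c m2 (0 : VecField P j ℝ) φ * ((X φ - d20 * massForm w φ) *
            ((∑ y : Site P j, w * wick4 w c m2 y φ) * (∑ y : Site P j, w * wick4 w c m2 y φ)))) *
            (∫ φ : Cfg P j N, weight C η w c m2 (0 : VecField P j ℝ) φ)
          - (∫ φ : Cfg P j N, weight C η w c m2 (0 : VecField P j ℝ) φ *
              ((∑ y : Site P j, w * wick4 w c m2 y φ) * (∑ y : Site P j, w * wick4 w c m2 y φ))) *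
            (∫ φ : Cfg P j N, weight C η w c m2 (0 : VecField P j ℝ) φ * (X φ - d20 * massForm w φ))) /
          (∫ φ : Cfg P j N, weight C η w c m2 (0 : VecField P j ℝ) φ) ^ 2
        - d02 * (((∫ φ : Cfg P j N, weight C η w c m2 (0 : VecField P j ℝ) φ * ((X φ - d20 * massForm w φ) * massForm w φ)) *
              (∫ φ : Cfg P j N, weight C η w c m2 (0 : VecField P j ℝ) φ)
            - (∫ φ : Cfg P j N, weight C η w c m2 (0 : VecField P j ℝ) φ * massForm w φ) *
              (∫ φ : Cfg P j N, weight C η w c m2 (0 : VecField P j ℝ) φ * (X φ - d20 * massForm w φ))) /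
            (∫ φ : Cfg P j N, weight C η w c m2 (0 : VecField P j ℝ) φ) ^ 2)
        - 2 * d22 * (N * ∑ x : Site P j, w * G w c m2 x x) := by
  set U : Cfg P j N → ℝ := fun φ => (∑ y : Site P j, w * ‖φ y‖ ^ 4) + 1 / 2 * d01 * massForm w φ with hUd
  have hU : ∀ φ, U φ = (∑ y : Site P j, w * ‖φ y‖ ^ 4) + 1 / 2 * d01 * massForm w φ := fun φ => rfl
  set Y : Cfg P j N → ℝ := fun φ => X φ - d20 * massForm w φ with hYd
  have hY : ∀ φ, Y φ = X φ - d20 * massForm w φ := fun φ => rfl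
  set W : Cfg P j N → ℝ := fun φ => ∑ y : Site P j, w * wick4 w c m2 y φ with hWd
  have hW : ∀ φ, W φ = ∑ y : Site P j, w * wick4 w c m2 y φ := fun φ => rfl
  set K0 : ℝ := Fintype.card (Site P j) * (w * (N * (N + 2) * C0 (P := P) (j := j) w c m2 ^ 2)) with hK0
  have hUW : ∀ φ, U φ = W φ - K0 := fun φ => U_eq_sumWick4_of_print w c m2 d01 hd01 hU φ
  have hlhs : (fun e : ℝ => iteratedDerivWithin 2 (fun lam : ℝ => Real.log (∫ p : JCfg P j N,
        J C η w c (m2 + (d20 * e ^ 2 + d01 * lam + d21 * (e ^ 2 * lam) + d02 * lam ^ 2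
          + d22 * (e ^ 2 * lam ^ 2) + d40 * e ^ 4)) μ2 e p *
          Real.exp (-(lam * ∑ y : Site P j, w * ‖p.2 y‖ ^ 4)))) (Set.Ici 0) 0) =
      fun e : ℝ => iteratedDerivWithin 2 (fun lam : ℝ => Real.log (∫ p : JCfg P j N,
        J C η w c (m2 + (d20 * e ^ 2 + d01 * lam + d21 * (e ^ 2 * lam) + d02 * lam ^ 2
          + d22 * (e ^ 2 * lam ^ 2) + d40 * e ^ 4)) μ2 e p *
          Real.exp (-(lam * ∑ y : Site P j, w * ‖p.2 y‖ ^ 4)))) (Set.Ici 0) 0 := rfl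
  rw [iteratedDeriv_two_index22_eq_moments C η w c m2 μ2 hw hm hμ d20 d01 d21 d02 d22 d40 hX hU]
  -- change of variables `U = W − K₀` in the five moments
  have hXg := expGrowth_X C η w c μ2 hX
  have hmF := B3Eq123RenormalizationConditions.expGrowth_massForm (P := P) (j := j) (N := N) w
  have hYg : ExpGrowth Y := hXg.sub (hmF.const_mul d20)
  have hWg : ExpGrowth W := ExpGrowth.sum _ fun y _ => (expGrowth_wick4 w c m2 y).const_mul w
  have h1g : ExpGrowth (fun _ : Cfg P j N => (1 : ℝ)) := ExpGrowth.const 1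
  have iYWW := (hYg.mul (hWg.mul hWg)).integrable C η w c m2 hw hm
  have iYW := (hWg.mul hYg).integrable C η w c m2 hw hm
  have iY := hYg.integrable C η w c m2 hw hm
  have iWW := (hWg.mul hWg).integrable C η w c m2 hw hm
  have iW := hWg.integrable C η w c m2 hw hm
  have i1 := h1g.integrable C η w c m2 hw hm
  have iWQ := (hWg.mul hmF).integrable C η w c m2 hw hm
  have iQ := hmF.integrable C η w c m2 hw hm
  have hYW0 : (∫ φ : Cfg P j N, weight C η w c m2 (0 : VecField P j ℝ) φ * (W φ * Y φ)) = 0 :=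
    integral_W_Y C η w c m2 μ2 hw hm d20 hX hY hW
  have hW0 : (∫ φ : Cfg P j N, weight C η w c m2 (0 : VecField P j ℝ) φ * W φ) = 0 :=
    B3Eq122FirstOrderWick.integral_sumWick4 C η w c m2 hw hm
  have hWQ0 : (∫ φ : Cfg P j N, weight C η w c m2 (0 : VecField P j ℝ) φ * (W φ * massForm w φ)) = 0 :=
    integral_W_massForm C η w c m2 hw hm hW
  -- `M(Y·U²) = M(Y·W²) + K₀²M(Y)`
  have e1 : (∫ φ : Cfg P j N, weight C η w c m2 (0 : VecField P j ℝ) φ * ((X φ - d20 * massForm w φ) * (U φ * U φ))) =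
      (∫ φ : Cfg P j N, weight C η w c m2 (0 : VecField P j ℝ) φ * ((X φ - d20 * massForm w φ) * (W φ * W φ)))
        + K0 ^ 2 * ∫ φ : Cfg P j N, weight C η w c m2 (0 : VecField P j ℝ) φ * (X φ - d20 * massForm w φ) := by
    have h : (fun φ : Cfg P j N => weight C η w c m2 (0 : VecField P j ℝ) φ * ((X φ - d20 * massForm w φ) * (U φ * U φ))) =
        fun φ => (weight C η w c m2 (0 : VecField P j ℝ) φ * (Y φ * (W φ * W φ))
          - 2 * K0 * (weight C η w c m2 (0 : VecField P j ℝ) φ * (W φ * Y φ)))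
          + K0 ^ 2 * (weight C η w c m2 (0 : VecField P j ℝ) φ * Y φ) := by
      funext φ; rw [hUW, hY]; ring
    have iA : Integrable (fun φ : Cfg P j N => weight C η w c m2 (0 : VecField P j ℝ) φ * (Y φ * (W φ * W φ))
        - 2 * K0 * (weight C η w c m2 (0 : VecField P j ℝ) φ * (W φ * Y φ))) := iYWW.sub (iYW.const_mul _)
    have iB : Integrable (fun φ : Cfg P j N => 2 * K0 * (weight C η w c m2 (0 : VecField P j ℝ) φ * (W φ * Y φ))) :=
      iYW.const_mul _
    have iC : Integrable (fun φ : Cfg P j N => K0 ^ 2 * (weight C η w c m2 (0 : VecField P j ℝ) φ * Y φ)) := iY.const_mul _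
    rw [h, integral_add iA iC, integral_sub iYWW iB, integral_const_mul, integral_const_mul, hYW0]
    simp only [hY, mul_zero, sub_zero]
  -- `M(U²) = M(W²) + K₀²Z`
  have e2 : (∫ φ : Cfg P j N, weight C η w c m2 (0 : VecField P j ℝ) φ * (U φ * U φ)) =
      (∫ φ : Cfg P j N, weight C η w c m2 (0 : VecField P j ℝ) φ * (W φ * W φ))
        + K0 ^ 2 * ∫ φ : Cfg P j N, weight C η w c m2 (0 : VecField P j ℝ) φ := by
    have h : (fun φ : Cfg P j N => weight C η w c m2 (0 : VecField P j ℝ) φ * (U φ * U φ)) =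
        fun φ => (weight C η w c m2 (0 : VecField P j ℝ) φ * (W φ * W φ)
          - 2 * K0 * (weight C η w c m2 (0 : VecField P j ℝ) φ * W φ))
          + K0 ^ 2 * (weight C η w c m2 (0 : VecField P j ℝ) φ * 1) := by
      funext φ; rw [hUW]; ring
    have i1' : Integrable (fun φ : Cfg P j N => K0 ^ 2 * (weight C η w c m2 (0 : VecField P j ℝ) φ * 1)) := i1.const_mul _
    have iA : Integrable (fun φ : Cfg P j N => weight C η w c m2 (0 : VecField P j ℝ) φ * (W φ * W φ)
        - 2 * K0 * (weight C η w c m2 (0 : VecField P j ℝ) φ * W φ)) := iWW.sub (iW.const_mul _)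
    have iB : Integrable (fun φ : Cfg P j N => 2 * K0 * (weight C η w c m2 (0 : VecField P j ℝ) φ * W φ)) := iW.const_mul _
    rw [h, integral_add iA i1', integral_sub iWW iB, integral_const_mul, integral_const_mul, hW0]
    simp only [mul_one, mul_zero, sub_zero]
  -- `M(U) = −K₀Z`
  have e3 : (∫ φ : Cfg P j N, weight C η w c m2 (0 : VecField P j ℝ) φ * U φ) =
      -(K0 * ∫ φ : Cfg P j N, weight C η w c m2 (0 : VecField P j ℝ) φ) := by
    have h : (fun φ : Cfg P j N => weight C η w c m2 (0 : VecField P j ℝ) φ * U φ) =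
        fun φ => weight C η w c m2 (0 : VecField P j ℝ) φ * W φ - K0 * (weight C η w c m2 (0 : VecField P j ℝ) φ * 1) := by
      funext φ; rw [hUW]; ring
    have i1' : Integrable (fun φ : Cfg P j N => K0 * (weight C η w c m2 (0 : VecField P j ℝ) φ * 1)) := i1.const_mul K0
    rw [h, integral_sub iW i1', integral_const_mul, hW0]
    simp only [mul_one]
    ring
  -- `M(Y·U) = −K₀M(Y)`
  have e4 : (∫ φ : Cfg P j N, weight C η w c m2 (0 : VecField P j ℝ) φ * ((X φ - d20 * massForm w φ) * U φ)) =
      -(K0 * ∫ φ : Cfg P j N, weight C η w c m2 (0 : VecField P j ℝ) φ * (X φ - d20 * massForm w φ)) := by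
    have h : (fun φ : Cfg P j N => weight C η w c m2 (0 : VecField P j ℝ) φ * ((X φ - d20 * massForm w φ) * U φ)) =
        fun φ => weight C η w c m2 (0 : VecField P j ℝ) φ * (W φ * Y φ)
          - K0 * (weight C η w c m2 (0 : VecField P j ℝ) φ * Y φ) := by
      funext φ; rw [hUW, hY]; ring
    have iC : Integrable (fun φ : Cfg P j N => K0 * (weight C η w c m2 (0 : VecField P j ℝ) φ * Y φ)) := iY.const_mul K0
    rw [h, integral_sub iYW iC, integral_const_mul, hYW0]
    simp only [hY]
    ring
  -- `M(U·Q) = −K₀M(Q)`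
  have e5 : (∫ φ : Cfg P j N, weight C η w c m2 (0 : VecField P j ℝ) φ * (U φ * massForm w φ)) =
      -(K0 * ∫ φ : Cfg P j N, weight C η w c m2 (0 : VecField P j ℝ) φ * massForm w φ) := by
    have h : (fun φ : Cfg P j N => weight C η w c m2 (0 : VecField P j ℝ) φ * (U φ * massForm w φ)) =
        fun φ => weight C η w c m2 (0 : VecField P j ℝ) φ * (W φ * massForm w φ)
          - K0 * (weight C η w c m2 (0 : VecField P j ℝ) φ * massForm w φ) := by
      funext φ; rw [hUW]; ring
    have iC : Integrable (fun φ : Cfg P j N => K0 * (weight C η w c m2 (0 : VecField P j ℝ) φ * massForm w φ)) :=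
      iQ.const_mul K0
    rw [h, integral_sub iWQ iC, integral_const_mul, hWQ0]
    ring
  rw [e1, e2, e3, e4, e5, integral_W0_massForm C η w c m2 hw hm]
  have hM0 : (∫ φ : Cfg P j N, weight C η w c m2 (0 : VecField P j ℝ) φ) ≠ 0 := (B3WT226Traces.Z_pos C η w c m2 hw hm).ne'
  field_simp
  ring

/-- **THE `(2,2)` TERM OF `E₁`** (body of record `B3Sect1TwoPoint.E1of124R`: `(α!β!)⁻¹e^αλ^β·iteratedDeriv α (e′ ↦ iteratedDerivWithin β
(λ′ ↦ log Z(e′,λ′)) [0,∞) 0) 0`), at print's `δm²_{(0,1)}`: **`(2!·2!)⁻¹e²λ²·[κ₃(Y; V_:, V_:) − δm²_{(0,2)}Cov₀(Y,Q) −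
2δm²_{(2,2)}N·Σ_xη^dC^ε_0(x,x)]`**. [cite: Balaban1983Higgs3, (1.24) p.417] -/
theorem E1_term_22_at_print_d01 (hw : 0 < w) (hm : 0 < m2) (hμ : 0 < μ2) (d20 d01 d21 d02 d22 d40 e lam : ℝ)
    (hd01 : d01 = -(4 * (N + 2) * C0 (P := P) (j := j) w c m2)) {X : Cfg P j N → ℝ}
    (hX : ∀ φ, X φ = (∑ b : PBond P j, w * (c ^ 2 * η ^ 2) * G w c μ2 b.src b.src * ⟪φ b.src, C.q (C.q (φ b.tgt))⟫_ℝ)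
      + ∑ b : PBond P j, ∑ b' : PBond P j, (w * (c ^ 2 * η)) * (w * (c ^ 2 * η)) *
          (G w c μ2 b.src b'.src * if b.dir = b'.dir then 1 else 0) *
            (⟪φ b.src, C.q (φ b.tgt)⟫_ℝ * ⟪φ b'.src, C.q (φ b'.tgt)⟫_ℝ)) :
    1 / ((Nat.factorial 2 : ℝ) * (Nat.factorial 2 : ℝ)) * e ^ 2 * lam ^ 2 *
        iteratedDeriv 2 (fun e' : ℝ => iteratedDerivWithin 2 (fun lam' : ℝ => Real.log (∫ p : JCfg P j N,
          J C η w c (m2 + (d20 * e' ^ 2 + d01 * lam' + d21 * (e' ^ 2 * lam') + d02 * lam' ^ 2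
            + d22 * (e' ^ 2 * lam' ^ 2) + d40 * e' ^ 4)) μ2 e' p *
            Real.exp (-(lam' * ∑ y : Site P j, w * ‖p.2 y‖ ^ 4)))) (Set.Ici 0) 0) 0 =
      1 / 4 * (e ^ 2 * lam ^ 2) *
        (((∫ φ : Cfg P j N, weight C η w c m2 (0 : VecField P j ℝ) φ * ((X φ - d20 * massForm w φ) *
              ((∑ y : Site P j, w * wick4 w c m2 y φ) * (∑ y : Site P j, w * wick4 w c m2 y φ)))) *
              (∫ φ : Cfg P j N, weight C η w c m2 (0 : VecField P j ℝ) φ)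
            - (∫ φ : Cfg P j N, weight C η w c m2 (0 : VecField P j ℝ) φ *
                ((∑ y : Site P j, w * wick4 w c m2 y φ) * (∑ y : Site P j, w * wick4 w c m2 y φ))) *
              (∫ φ : Cfg P j N, weight C η w c m2 (0 : VecField P j ℝ) φ * (X φ - d20 * massForm w φ))) /
            (∫ φ : Cfg P j N, weight C η w c m2 (0 : VecField P j ℝ) φ) ^ 2
          - d02 * (((∫ φ : Cfg P j N, weight C η w c m2 (0 : VecField P j ℝ) φ * ((X φ - d20 * massForm w φ) * massForm w φ)) *
                (∫ φ : Cfg P j N, weight C η w c m2 (0 : VecField P j ℝ) φ)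
              - (∫ φ : Cfg P j N, weight C η w c m2 (0 : VecField P j ℝ) φ * massForm w φ) *
                (∫ φ : Cfg P j N, weight C η w c m2 (0 : VecField P j ℝ) φ * (X φ - d20 * massForm w φ))) /
              (∫ φ : Cfg P j N, weight C η w c m2 (0 : VecField P j ℝ) φ) ^ 2)
          - 2 * d22 * (N * ∑ x : Site P j, w * G w c m2 x x)) := by
  rw [iteratedDeriv_two_index22_at_print_d01 C η w c m2 μ2 hw hm hμ d20 d01 d21 d02 d22 d40 hd01 hX]
  simp only [Nat.factorial, Nat.succ_eq_add_one, Nat.cast_mul]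
  ring

omit C η μ2 in
/-- the `δm²_{(2,2)}` bubble is extensive: `2δm²_{(2,2)}·N·Σ_xη^dC^ε_0(x,x) = ∣T_ε∣·2δm²_{(2,2)}Nη^dC^ε_0(0)`.
[cite: Balaban1983Higgs3, (1.24) p.417] -/
theorem bubble22_eq_card_mul (d22 : ℝ) :
    2 * d22 * (N * ∑ x : Site P j, w * G w c m2 x x) = Fintype.card (Site P j) * (2 * d22 * N * (w * C0 (P := P) (j := j) w c m2)) := by
  rw [B3Eq124IndexTwoOne.sum_G_diag w c m2]
  ring


/-- **AT PRINT'S SERIES EXACTLY** (`δm² = Σ_{2≦α+2β≦4}e^αλ^βδm²_{(α,β)}` has NO `e²λ²` term: `α + 2β = 6 > 4`, so `d22 = 0`):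
at print's `δm²_{(0,1)}` the `(2,2)` derivative of the body of record is **`κ₃(Y; V_:, V_:) − δm²_{(0,2)}·Cov₀(Y,Q)`** — the sunset
of two Wick-ordered quartic vertices dressed by the subtracted order-`e²` insertion, and the `δm²_{(0,2)}` bubble dressed likewise
(cumulant form; kernels not evaluated). [cite: Balaban1983Higgs3, (1.23)–(1.24) p.417] [cite: GlimmJaffeQP1987, Cor. 8.3.2] -/
theorem iteratedDeriv_two_index22_at_print_series (hw : 0 < w) (hm : 0 < m2) (hμ : 0 < μ2) (d20 d01 d21 d02 d40 : ℝ)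
    (hd01 : d01 = -(4 * (N + 2) * C0 (P := P) (j := j) w c m2)) {X : Cfg P j N → ℝ}
    (hX : ∀ φ, X φ = (∑ b : PBond P j, w * (c ^ 2 * η ^ 2) * G w c μ2 b.src b.src * ⟪φ b.src, C.q (C.q (φ b.tgt))⟫_ℝ)
      + ∑ b : PBond P j, ∑ b' : PBond P j, (w * (c ^ 2 * η)) * (w * (c ^ 2 * η)) *
          (G w c μ2 b.src b'.src * if b.dir = b'.dir then 1 else 0) *
            (⟪φ b.src, C.q (φ b.tgt)⟫_ℝ * ⟪φ b'.src, C.q (φ b'.tgt)⟫_ℝ)) :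
    iteratedDeriv 2 (fun e : ℝ => iteratedDerivWithin 2 (fun lam : ℝ => Real.log (∫ p : JCfg P j N,
        J C η w c (m2 + (d20 * e ^ 2 + d01 * lam + d21 * (e ^ 2 * lam) + d02 * lam ^ 2 + d40 * e ^ 4)) μ2 e p *
          Real.exp (-(lam * ∑ y : Site P j, w * ‖p.2 y‖ ^ 4)))) (Set.Ici 0) 0) 0 =
      ((∫ φ : Cfg P j N, weight C η w c m2 (0 : VecField P j ℝ) φ * ((X φ - d20 * massForm w φ) *
            ((∑ y : Site P j, w * wick4 w c m2 y φ) * (∑ y : Site P j, w * wick4 w c m2 y φ)))) *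
            (∫ φ : Cfg P j N, weight C η w c m2 (0 : VecField P j ℝ) φ)
          - (∫ φ : Cfg P j N, weight C η w c m2 (0 : VecField P j ℝ) φ *
              ((∑ y : Site P j, w * wick4 w c m2 y φ) * (∑ y : Site P j, w * wick4 w c m2 y φ))) *
            (∫ φ : Cfg P j N, weight C η w c m2 (0 : VecField P j ℝ) φ * (X φ - d20 * massForm w φ))) /
          (∫ φ : Cfg P j N, weight C η w c m2 (0 : VecField P j ℝ) φ) ^ 2
        - d02 * (((∫ φ : Cfg P j N, weight C η w c m2 (0 : VecField P j ℝ) φ * ((X φ - d20 * massForm w φ) * massForm w φ)) *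
              (∫ φ : Cfg P j N, weight C η w c m2 (0 : VecField P j ℝ) φ)
            - (∫ φ : Cfg P j N, weight C η w c m2 (0 : VecField P j ℝ) φ * massForm w φ) *
              (∫ φ : Cfg P j N, weight C η w c m2 (0 : VecField P j ℝ) φ * (X φ - d20 * massForm w φ))) /
            (∫ φ : Cfg P j N, weight C η w c m2 (0 : VecField P j ℝ) φ) ^ 2) := by
  have h := iteratedDeriv_two_index22_at_print_d01 C η w c m2 μ2 hw hm hμ d20 d01 d21 d02 0 d40 hd01 hX
  have hfun : (fun e : ℝ => iteratedDerivWithin 2 (fun lam : ℝ => Real.log (∫ p : JCfg P j N,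
        J C η w c (m2 + (d20 * e ^ 2 + d01 * lam + d21 * (e ^ 2 * lam) + d02 * lam ^ 2 + d40 * e ^ 4)) μ2 e p *
          Real.exp (-(lam * ∑ y : Site P j, w * ‖p.2 y‖ ^ 4)))) (Set.Ici 0) 0) =
      fun e : ℝ => iteratedDerivWithin 2 (fun lam : ℝ => Real.log (∫ p : JCfg P j N,
        J C η w c (m2 + (d20 * e ^ 2 + d01 * lam + d21 * (e ^ 2 * lam) + d02 * lam ^ 2
          + 0 * (e ^ 2 * lam ^ 2) + d40 * e ^ 4)) μ2 e p *
          Real.exp (-(lam * ∑ y : Site P j, w * ‖p.2 y‖ ^ 4)))) (Set.Ici 0) 0 := by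
    funext e
    congr 1
    funext lam
    rw [zero_mul, add_zero]
  rw [hfun, h]
  ring


end Literature.MathematicalPhysics.QuantumFieldTheory.Balaban1983to89.B3Eq124IndexTwoTwo
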